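import Literature.MathematicalPhysics.QuantumFieldTheory.Balaban1983to89.B4Thm112RegionLp
import Literature.MathematicalPhysics.QuantumFieldTheory.Balaban1983to89.B4HolderLetterRegion
import Literature.MathematicalPhysics.QuantumFieldTheory.Balaban1983to89.B4Ineq112LpChainMembers
import Literature.MathematicalPhysics.QuantumFieldTheory.Balaban1983to89.B4Lemma22HolderCubeField

/-!
# `Balaban1983to89.B4Thm112RegionLpHolder` — [Balaban1983RegularityDecay] THEOREM p. 573, (1.11)–(1.12): THE δG CLAUSE,
# HÖLDER MEMBER (the inequality (1.9) for `δG_k(Ω,Ω₀,A)`), FOR A GENERAL PAIR `Ω ⊂ Ω₀` OF FINITE UNIONS OF `K`-BLOCKS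
# UNDER `R₀`, CLOSE PAIRS, UNIFORM IN `η` — r01 g6's δG Hölder chain `B4Ineq112LpChainMembers.ineq112_holder_lp` on the
# two cube-propagator families of `B4CubeGreenRegionPair`, the per-cube Hölder letter by `B4HolderLetterRegion`

statement-level skeleton of published theorems with citation tags; proofs where landed; nothing here is a claim about the Yang–Mills mass gap

WHAT THIS FILE DOES.  §1 **`thm112_holder_region_of_inputs`**: the setting of `B4Thm112RegionLp` (sites of `Ω₀`,
`G = pairGreen`, `G′ = G_k(Ω₀,A)`, families `atGreen₂`/`atGreenΩ`, `good j ⟺ □̂_j ⊆ Ω`) with the Hölder probe of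
`B4Thm19RegionLp.thm19_holder_region_of_inputs` (pair `x ≠ x′` in `Ω` with both forward bonds in `Ω`,
`32|x−x′|_∞ ≤ ηM`, nearest-neighbour contour `Γ = (x, l)` in `Ω`; the per-cube Hölder input `γ_H` at the cubes
interior to `Ω` for BOTH families — their `h_jG_jh_j` letters coincide there, `letterΩ_a_eq`); `R₀` radius `K(n₀+3)`.
CONCLUSION: `(η^{-1}/|x−x′|_∞)^α·|(U(A(Γ))(D^η_{A,μ}u_Ω)(x′) − (D^η_{A,μ}u_Ω)(x) − (U(A(Γ))(D^η_{A,μ}u₀)(x′) − (D^η_{A,μ}u₀)(x)))_i|`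
`≤ 2^{d+5}e^{9/2}·γ_H·V·exp(−(D+D₀+D₁)/(2nK))·‖f‖_∞`, `u_Ω = G_k(Ω,A)(f|_Ω)`, `u₀ = G_k(Ω₀,A)f`.
§2 **`thm112_holder_region`** — hypothesis-free («e sufficiently small»), the inputs discharged as in
`B4Thm19RegionLp.thm19_holder_region` and `B4Thm112RegionLp.thm112_value_region`.

HONEST SCOPE.  As `B4Thm112RegionLp` and `B4Thm19RegionLp` (cube configurations `Ã_j` inside `Ω`, `A` elsewhere —
DISCLOSED; close pairs `32|x−x′|_∞ ≤ ηM` only — far pairs follow from the derivative member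
`B4Thm112RegionLpDeriv` at `x` and `x′` as in `B4Thm19RegionLpAll`, not repeated here; the contour inside `Ω`, read on
`Ω₀` through the inclusion).  No `Prop` fact, no `sorry`; axioms standard.
-/

namespace Literature.MathematicalPhysics.QuantumFieldTheory.Balaban1983to89.B4Thm112RegionLpHolder




open Literature.MathematicalPhysics.QuantumFieldTheory.Balaban1983to89.B4Reflection242 (boxDom mem_boxDom nbrs mem_nbrs
  blk blk_mem_boxDom)
open Literature.MathematicalPhysics.QuantumFieldTheory.Balaban1983to89.B4GaugeCovariance
open Literature.MathematicalPhysics.QuantumFieldTheory.Balaban1983to89.B4Commutators25to211 (mulH opK)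
open Literature.MathematicalPhysics.QuantumFieldTheory.Balaban1983to89.B4Lower18 (fineDom mem_fineDom IsBlockUnion)
open Literature.MathematicalPhysics.QuantumFieldTheory.Balaban1983to89.B4Lower18Regular (e1 baseEmb stairContour
  base_le_of_blk)
open Literature.MathematicalPhysics.QuantumFieldTheory.Balaban1983to89.B4Lower18RegularRegion (regWt rBlkWt rbaseEmb
  rstairContour regWt_nonneg rBlkWt_ne_zero compField)
open Literature.MathematicalPhysics.QuantumFieldTheory.Balaban1983to89.B4Lemma21Region (regionOp regionDeriv covDeriv
  siteNorm fld_covDeriv_mulVec_of_mem)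
open Literature.MathematicalPhysics.QuantumFieldTheory.Balaban1983to89.B4Lemma22ReduceZero (Box opA greenA derivA)
open Literature.MathematicalPhysics.QuantumFieldTheory.Balaban1983to89.B4Lemma22Reduce231 (supN supN_nonneg)
open Literature.MathematicalPhysics.QuantumFieldTheory.Balaban1983to89.B4Lemma22EtaBox (vol vol_pos lpW lpW_nonneg)
open Literature.MathematicalPhysics.QuantumFieldTheory.Balaban1983to89.B4Lemma22LpStair (lpM lpM_nonneg)
open Literature.MathematicalPhysics.QuantumFieldTheory.Balaban1983to89.B4PartitionUnity22 (hCube hCube_nonneg hCube_le_one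
  hCube_ne_zero_imp mem_box_of_hCube_ne_zero hprof D1 D2 D1_nonneg D2_nonneg contDiff_hprof hasCompactSupport_hprof)
open Literature.MathematicalPhysics.QuantumFieldTheory.Balaban1983to89.B4Eq220PartitionSizes (hZ hBox)
open Literature.MathematicalPhysics.QuantumFieldTheory.Balaban1983to89.B4Eq220CommutatorField (kOp)
open Literature.MathematicalPhysics.QuantumFieldTheory.Balaban1983to89.B4CubeFields22 (cubeField cubeField_eq_compField)
open Literature.MathematicalPhysics.QuantumFieldTheory.Balaban1983to89.B4CubeFieldHyps22 (aSeq_window cubeField_threshold)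
open Literature.MathematicalPhysics.QuantumFieldTheory.Balaban1983to89.B4Eq220CubeField (lemma22_sup_cubeField
  eq220_cubeField_std eq221_cubeField)
open Literature.MathematicalPhysics.QuantumFieldTheory.Balaban1983to89.B4Eq221PsupCubeField (eq221_psup_cubeField_std)
open Literature.MathematicalPhysics.QuantumFieldTheory.Balaban1983to89.B4Eq221L2FactorRegion (acBond kOpR)
open Literature.MathematicalPhysics.QuantumFieldTheory.Balaban1983to89.B4Eq221HjRegion (eq221_l2_region_hZ hsizeR_hZ)
open Literature.MathematicalPhysics.QuantumFieldTheory.Balaban1983to89.B4CubeOpReindex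
open Literature.MathematicalPhysics.QuantumFieldTheory.Balaban1983to89.B4WalkRouteRegion (rpos labels labels_complete
  regWt_local rBlkWt_local green_mul_op)
open Literature.MathematicalPhysics.QuantumFieldTheory.Balaban1983to89.B4Ineq110WalkRoute (norm_mulH_le)
open Literature.MathematicalPhysics.QuantumFieldTheory.Balaban1983to89.B4Ineq110WalkRouteDeriv (unitOp_apply
  unitOp_mul_mulH norm_unitOp_le fld_bondOp_mulVec)
open Literature.MathematicalPhysics.QuantumFieldTheory.Balaban1983to89.B4Thm110BoxDerivWalk (probe_mul_mulH
  fld_probe_mulVec_self row_abs_sum_U_le)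
open Literature.MathematicalPhysics.QuantumFieldTheory.Balaban1983to89.B4RegionCubeCarrier
open Literature.MathematicalPhysics.QuantumFieldTheory.Balaban1983to89.B4CubeGreenRegion
open Literature.MathematicalPhysics.QuantumFieldTheory.Balaban1983to89.B4LpNormTransfer
open Literature.MathematicalPhysics.QuantumFieldTheory.Balaban1983to89.B4Thm110RegionLp
open Literature.MathematicalPhysics.QuantumFieldTheory.Balaban1983to89.B4Ineq110LpChain (lpv lpv_nonneg lvl lvl_zero
  lvl_succ lpv_two_le)
open Literature.MathematicalPhysics.QuantumFieldTheory.Balaban1983to89.B4Ineq112LpChainMembers (ineq112_holder_lp_apply)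
open Literature.MathematicalPhysics.QuantumFieldTheory.Balaban1983to89.B4Ineq19WalkRoute (holderOp_mul_mulH)
open Literature.MathematicalPhysics.QuantumFieldTheory.Balaban1983to89.B4ContourShift (supNorm supNorm_nonneg abs_le_supNorm)
open Literature.MathematicalPhysics.QuantumFieldTheory.Balaban1983to89.B4Lemma22HolderBox (IsNNChain transport_fieldLink)
open Literature.MathematicalPhysics.QuantumFieldTheory.Balaban1983to89.B4HolderChainTools (one_le_supNorm_of_ne)
open Literature.MathematicalPhysics.QuantumFieldTheory.Balaban1983to89.B4HolderLetterRegion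
open Literature.MathematicalPhysics.QuantumFieldTheory.Balaban1983to89.B4Lemma22HolderCubeField (lemma22_holder_cubeField)
open Literature.MathematicalPhysics.QuantumFieldTheory.Balaban1983to89.B4Thm110RegionLpDeriv (chainLetter chain_letter_inputs
  probe_atGreen_le)
open Literature.MathematicalPhysics.QuantumFieldTheory.Balaban1983to89.B4RegionPairGreen
open Literature.MathematicalPhysics.QuantumFieldTheory.Balaban1983to89.B4CubeGreenRegionPair
open Literature.MathematicalPhysics.QuantumFieldTheory.Balaban1983to89.B4PairLetterL2 (lpv_two_letterΩ_bad_le)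
open Literature.MathematicalPhysics.QuantumFieldTheory.Balaban1983to89.B4Thm112RegionLp
open scoped Matrix
open scoped Matrix.Norms.Operator

noncomputable section

variable {d : ℕ}

/-! ## §1. (1.11)–(1.12), Hölder member, on a general pair from the per-cube inputs -/

section Inputs

variable {ι : Type} [Fintype ι] [DecidableEq ι]

omit [Fintype ι] [DecidableEq ι] in
/-- `|e_μ(ν)| ≤ 1`. [folklore] -/
private theorem abs_e1_cast_le (μ ν : Fin (d + 1)) : |((e1 μ ν : ℤ) : ℝ)| ≤ 1 := by
  by_cases h : ν = μ
  · subst h; simp [B4Lower18Regular.e1_apply_self]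
  · simp [B4Lower18Regular.e1_apply_ne h]

omit [Fintype ι] [DecidableEq ι] in
/-- two sites within `n·q` of each other coordinatewise have unit blocks within `q`. [folklore] -/
private theorem abs_blk_sub_blk_le {n : ℕ} (hn : 1 ≤ n) {u v : Fin (d + 1) → ℤ} {q : ℕ} (ν : Fin (d + 1))
    (h : ((|u ν - v ν| : ℤ) : ℝ) ≤ (n : ℝ) * q) : |blk n u ν - blk n v ν| ≤ q := by
  have hn0 : (0 : ℤ) < n := by exact_mod_cast hn
  have h' : |u ν - v ν| ≤ (n : ℤ) * q := by exact_mod_cast h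
  obtain ⟨h1, h2⟩ := abs_le.mp h'
  show |u ν / (n : ℤ) - v ν / (n : ℤ)| ≤ q
  rw [abs_le]
  constructor
  · have h3 : (v ν + (-(q : ℤ)) * (n : ℤ)) / (n : ℤ) ≤ u ν / (n : ℤ) := Int.ediv_le_ediv hn0 (by linarith)
    rw [Int.add_mul_ediv_right _ _ hn0.ne'] at h3
    linarith
  · have h3 : u ν / (n : ℤ) ≤ (v ν + (q : ℤ) * (n : ℤ)) / (n : ℤ) := Int.ediv_le_ediv hn0 (by linarith)
    rw [Int.add_mul_ediv_right _ _ hn0.ne'] at h3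
    linarith

omit [Fintype ι] [DecidableEq ι] in
/-- a site of the cube `□_j` (label in `[K(j−1), K(j+1))^{d+1}`) is within `M = nK` of the centre `nKj` (the chain's
`hS1`). [cite: Balaban1983RegularityDecay, §2 p.575 «□_j … a cube of the size 2M and with center in Mj»] -/
private theorem abs_rpos_sub_le_of_cubeS' {ℓ k : ℕ} (hn : 1 ≤ (ℓ + 1) ^ k) (Ω₀c : Finset (Fin (d + 1) → ℤ)) (K : ℕ)
    (j : Fin (d + 1) → ℤ) (z : ↥(fineDom ((ℓ + 1) ^ k) Ω₀c)) (hz : cubeS ℓ k Ω₀c K j z) (μ : Fin (d + 1)) :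
    |rpos ((ℓ + 1) ^ k) Ω₀c z μ - ((((ℓ + 1) ^ k : ℕ) : ℝ) * K) * j μ| ≤ (((ℓ + 1) ^ k : ℕ) : ℝ) * K := by
  have hn0 : (0 : ℤ) < ((((ℓ + 1) ^ k : ℕ)) : ℤ) := by exact_mod_cast hn
  obtain ⟨h1, h2⟩ := hz μ
  simp only [cshift] at h1 h2
  have hdiv := Int.mul_ediv_add_emod (z.1 μ) ((((ℓ + 1) ^ k : ℕ)) : ℤ)
  have hr0 := Int.emod_nonneg (z.1 μ) hn0.ne'
  have hr1 := Int.emod_lt_of_pos (z.1 μ) hn0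
  have hb : blk ((ℓ + 1) ^ k) z.1 μ = z.1 μ / ((((ℓ + 1) ^ k : ℕ)) : ℤ) := rfl
  rw [hb] at h1 h2
  have hlo : ((((ℓ + 1) ^ k : ℕ)) : ℤ) * ((K : ℤ) * (j μ - 1)) ≤ z.1 μ := by
    have := mul_le_mul_of_nonneg_left h1 hn0.le
    linarith
  have hhi : z.1 μ < ((((ℓ + 1) ^ k : ℕ)) : ℤ) * ((K : ℤ) * (j μ - 1) + 2 * K) := by
    have h2' : z.1 μ / ((((ℓ + 1) ^ k : ℕ)) : ℤ) < (K : ℤ) * (j μ - 1) + 2 * K := by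
      have := h2; simp only [Nat.cast_mul, Nat.cast_ofNat] at this; exact this
    have h3 : z.1 μ / ((((ℓ + 1) ^ k : ℕ)) : ℤ) + 1 ≤ (K : ℤ) * (j μ - 1) + 2 * K := Int.add_one_le_iff.mpr h2'
    have := mul_le_mul_of_nonneg_left h3 hn0.le
    linarith
  have hlo' : ((((ℓ + 1) ^ k : ℕ) : ℝ)) * ((K : ℝ) * ((j μ : ℝ) - 1)) ≤ ((z.1 μ : ℤ) : ℝ) := by exact_mod_cast hlo
  have hhi' : ((z.1 μ : ℤ) : ℝ) < ((((ℓ + 1) ^ k : ℕ) : ℝ)) * ((K : ℝ) * ((j μ : ℝ) - 1) + 2 * K) := by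
    exact_mod_cast hhi
  show |((z.1 μ : ℤ) : ℝ) - _| ≤ _
  rw [abs_le]
  constructor <;> nlinarith

omit [Fintype ι] [DecidableEq ι] in
/-- a nearest-neighbour chain of `Ω` read on the sites of `Ω₀`. [folklore] -/
private theorem isNNChain_map_incl {n : ℕ} (hn : 1 ≤ n) {Ω₀c Ωc : Finset (Fin (d + 1) → ℤ)} (hsub : Ωc ⊆ Ω₀c) :
    ∀ (a : ↥(fineDom n Ωc)) (l : List ↥(fineDom n Ωc)), IsNNChain a l →
      IsNNChain (incl hn hsub a) (l.map (incl hn hsub)) ∧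
        pathEnd (incl hn hsub a) (l.map (incl hn hsub)) = incl hn hsub (pathEnd a l) := by
  intro a l
  induction l generalizing a with
  | nil => exact fun _ => ⟨trivial, rfl⟩
  | cons b l ih =>
      intro hl
      obtain ⟨hb, hl'⟩ := hl
      exact ⟨⟨hb, (ih b hl').1⟩, (ih b hl').2⟩

set_option maxHeartbeats 800000 in
/-- **THEOREM (1.11)–(1.12), HÖLDER MEMBER, ON A GENERAL PAIR `Ω ⊂ Ω₀` UNDER `R₀`, CLOSE PAIRS, FROM THE PER-CUBE
INPUTS, UNIFORM IN `η`** (every structural hypothesis of r01 g6's `B4Ineq112LpChainMembers.ineq112_holder_lp`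
DISCHARGED).  INPUTS as `B4Thm112RegionLp.thm112_value_region_of_inputs` plus, at the cubes interior to `Ω₀` on the
translated boxes at `Ã_j`, the (2.17) derivative sup members (every `ν`) and the (2.16) Hölder member; the pair
`x ≠ x′` with `x + e_μ, x′ + e_μ ∈ Ω`, `32|x−x′|_∞ ≤ ηM`, the contour `Γ = (x, l)` a nearest-neighbour chain in `Ω` to
`x′` of length `≤ (d+1)|x−x′|_∞` within `|x−x′|_∞` of `x`; `R₀`: every unit label within `K(n₀+3)` of the block of
`x` lies in `Ω`.  CONCLUSION (`u_Ω = G_k(Ω,A)(f|_Ω)`, `u₀ = G_k(Ω₀,A)f`, `U = U(A(Γ))`, `w = (η^{-1}/|x−x′|_∞)^α`):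
`w·|(U(D^η_{A,μ}u_Ω)(x′) − (D^η_{A,μ}u_Ω)(x) − (U(D^η_{A,μ}u₀)(x′) − (D^η_{A,μ}u₀)(x)))_i| ≤ 2^{d+5}e^{9/2}·γ_H·V·exp(−(D+D₀+D₁)/(2nK))·‖f‖_∞`,
`γ_H = √N(c_H + (d+1)D₁c_D + (d+3)s c_D + (d+1)(D₁²+D₂)c_G)`.
[cite: Balaban1983RegularityDecay, Theorem (1.9), (1.11)–(1.12) p.573; (1.3)–(1.4) p.572; (2.2)–(2.3) p.575; (2.13) p.577; (2.16)–(2.22) pp.578–579] -/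
theorem thm112_holder_region_of_inputs (F : OrthFlow ι) (κ : ℝ) {ℓ k : ℕ} (hℓ : 1 ≤ ℓ) (hk : 1 ≤ k)
    (hn : 1 ≤ (ℓ + 1) ^ k) (Ω₀c Ωc : Finset (Fin (d + 1) → ℤ)) (hsub : Ωc ⊆ Ω₀c) {K : ℕ} (hK16 : 16 ≤ K)
    (hK4 : 4 ∣ K) {a m2 : ℝ} (ha : 0 < a) (hm : 0 ≤ m2) (Ac : (Fin (d + 1) → ℤ) → Fin (d + 1) → ℝ)
    {cG cK : ℝ} (hcG : 0 ≤ cG) (hcK : 0 ≤ cK) {n₀ : ℕ} (hn₀ : 0 < n₀)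
    (hG : ∀ j, cubeLabels K j ⊆ Ω₀c → ∀ Φ : ↥(Box d ℓ k fun _ : Fin (d + 1) => 2 * K) × ι → ℝ,
      supN (greenA d F κ ℓ k a m2 (fun _ => 2 * K) (baseEmb hn _) (stairContour hn _) (boxFld ℓ k K Ac j) *ᵥ Φ)
        ≤ cG * supN Φ)
    (h0 : ∀ j, cubeLabels K j ⊆ Ω₀c → ∀ Φ : ↥(Box d ℓ k fun _ : Fin (d + 1) => 2 * K) × ι → ℝ,
      supN (kOp F κ ((ℓ + 1) ^ k) (B1.aSeq a ((ℓ : ℝ) + 1) k) m2 (fun _ => 2 * K) (baseEmb hn _) (stairContour hn _)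
            (boxFld ℓ k K Ac j) (hBox ((ℓ + 1) ^ k) K (fun _ => 2 * K) (fun _ => 1))
          *ᵥ (greenA d F κ ℓ k a m2 (fun _ => 2 * K) (baseEmb hn _) (stairContour hn _) (boxFld ℓ k K Ac j)
            *ᵥ (mulH (ι := ι) (hBox ((ℓ + 1) ^ k) K (fun _ => 2 * K) (fun _ => 1)) *ᵥ Φ))) ≤ cK * supN Φ)
    (h1 : ∀ j, cubeLabels K j ⊆ Ω₀c → ∀ p : ℝ, 2 * (n₀ : ℝ) ≤ p →
      ∀ Φ : ↥(Box d ℓ k fun _ : Fin (d + 1) => 2 * K) × ι → ℝ,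
      supN (kOp F κ ((ℓ + 1) ^ k) (B1.aSeq a ((ℓ : ℝ) + 1) k) m2 (fun _ => 2 * K) (baseEmb hn _) (stairContour hn _)
            (boxFld ℓ k K Ac j) (hBox ((ℓ + 1) ^ k) K (fun _ => 2 * K) (fun _ => 1))
          *ᵥ (greenA d F κ ℓ k a m2 (fun _ => 2 * K) (baseEmb hn _) (stairContour hn _) (boxFld ℓ k K Ac j)
            *ᵥ (mulH (ι := ι) (hBox ((ℓ + 1) ^ k) K (fun _ => 2 * K) (fun _ => 1)) *ᵥ Φ))) ≤ cK * lpW d ℓ k p Φ)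
    (hg : ∀ j, cubeLabels K j ⊆ Ω₀c → ∀ p q : ℝ, 1 ≤ p → p ≤ q → p⁻¹ - q⁻¹ ≤ (2 * (n₀ : ℝ))⁻¹ →
      ∀ Φ : ↥(Box d ℓ k fun _ : Fin (d + 1) => 2 * K) × ι → ℝ,
      lpW d ℓ k q (kOp F κ ((ℓ + 1) ^ k) (B1.aSeq a ((ℓ : ℝ) + 1) k) m2 (fun _ => 2 * K) (baseEmb hn _)
            (stairContour hn _) (boxFld ℓ k K Ac j) (hBox ((ℓ + 1) ^ k) K (fun _ => 2 * K) (fun _ => 1))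
          *ᵥ (greenA d F κ ℓ k a m2 (fun _ => 2 * K) (baseEmb hn _) (stairContour hn _) (boxFld ℓ k K Ac j)
            *ᵥ (mulH (ι := ι) (hBox ((ℓ + 1) ^ k) K (fun _ => 2 * K) (fun _ => 1)) *ᵥ Φ))) ≤ cK * lpW d ℓ k p Φ)
    (hb : ∀ (j : Fin (d + 1) → ℤ) (Φ : ↥(fineDom ((ℓ + 1) ^ k) (subLabels Ω₀c K j)) × ι → ℝ),
      lpW d ℓ k 2 (opK (regWt ((ℓ + 1) ^ k) (fineDom ((ℓ + 1) ^ k) (subLabels Ω₀c K j))) m2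
            (B1.aSeq a ((ℓ : ℝ) + 1) k * (((((ℓ + 1) ^ k : ℕ)) : ℝ) ^ (d + 1))⁻¹)
            (rBlkWt ((ℓ + 1) ^ k) (subLabels Ω₀c K j) (fineDom ((ℓ + 1) ^ k) (subLabels Ω₀c K j)))
            (fieldLink F κ (acBond (subLabels Ω₀c K j) Ac))
            (contourTrans (fieldLink F κ (acBond (subLabels Ω₀c K j) Ac)) (rbaseEmb hn (subLabels Ω₀c K j))
              (rstairContour hn (subLabels Ω₀c K j)))
            (fun a : ↥(fineDom ((ℓ + 1) ^ k) (subLabels Ω₀c K j)) => hZ ((ℓ + 1) ^ k) K j a.1)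
          *ᵥ ((covOp (regWt ((ℓ + 1) ^ k) (fineDom ((ℓ + 1) ^ k) (subLabels Ω₀c K j))) m2
                (B1.aSeq a ((ℓ : ℝ) + 1) k * (((((ℓ + 1) ^ k : ℕ)) : ℝ) ^ (d + 1))⁻¹)
                (rBlkWt ((ℓ + 1) ^ k) (subLabels Ω₀c K j) (fineDom ((ℓ + 1) ^ k) (subLabels Ω₀c K j)))
                (fieldLink F κ (acBond (subLabels Ω₀c K j) Ac))
                (contourTrans (fieldLink F κ (acBond (subLabels Ω₀c K j) Ac)) (rbaseEmb hn (subLabels Ω₀c K j))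
                  (rstairContour hn (subLabels Ω₀c K j))))⁻¹
            *ᵥ (mulH (ι := ι) (fun a : ↥(fineDom ((ℓ + 1) ^ k) (subLabels Ω₀c K j)) => hZ ((ℓ + 1) ^ k) K j a.1)
              *ᵥ Φ))) ≤ cK * lpW d ℓ k 2 Φ)
    (hbΩ₁ : ∀ (j : Fin (d + 1) → ℤ) (Φ : ↥(fineDom ((ℓ + 1) ^ k) (Ωc ∩ cubeLabels K j)) × ι → ℝ),
      lpW d ℓ k 2 (opK (regWt ((ℓ + 1) ^ k) (fineDom ((ℓ + 1) ^ k) (Ωc ∩ cubeLabels K j))) m2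
            (B1.aSeq a ((ℓ : ℝ) + 1) k * (((((ℓ + 1) ^ k : ℕ)) : ℝ) ^ (d + 1))⁻¹)
            (rBlkWt ((ℓ + 1) ^ k) (Ωc ∩ cubeLabels K j) (fineDom ((ℓ + 1) ^ k) (Ωc ∩ cubeLabels K j)))
            (fieldLink F κ (acBond (Ωc ∩ cubeLabels K j) Ac))
            (contourTrans (fieldLink F κ (acBond (Ωc ∩ cubeLabels K j) Ac)) (rbaseEmb hn (Ωc ∩ cubeLabels K j))
              (rstairContour hn (Ωc ∩ cubeLabels K j)))
            (fun a : ↥(fineDom ((ℓ + 1) ^ k) (Ωc ∩ cubeLabels K j)) => hZ ((ℓ + 1) ^ k) K j a.1)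
          *ᵥ ((covOp (regWt ((ℓ + 1) ^ k) (fineDom ((ℓ + 1) ^ k) (Ωc ∩ cubeLabels K j))) m2
                (B1.aSeq a ((ℓ : ℝ) + 1) k * (((((ℓ + 1) ^ k : ℕ)) : ℝ) ^ (d + 1))⁻¹)
                (rBlkWt ((ℓ + 1) ^ k) (Ωc ∩ cubeLabels K j) (fineDom ((ℓ + 1) ^ k) (Ωc ∩ cubeLabels K j)))
                (fieldLink F κ (acBond (Ωc ∩ cubeLabels K j) Ac))
                (contourTrans (fieldLink F κ (acBond (Ωc ∩ cubeLabels K j) Ac)) (rbaseEmb hn (Ωc ∩ cubeLabels K j))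
                  (rstairContour hn (Ωc ∩ cubeLabels K j))))⁻¹
            *ᵥ (mulH (ι := ι) (fun a : ↥(fineDom ((ℓ + 1) ^ k) (Ωc ∩ cubeLabels K j)) => hZ ((ℓ + 1) ^ k) K j a.1) *ᵥ Φ))) ≤ cK * lpW d ℓ k 2 Φ)
    (hbΩ₂ : ∀ (j : Fin (d + 1) → ℤ) (Φ : ↥(fineDom ((ℓ + 1) ^ k) (subLabels Ω₀c K j \ (Ωc ∩ cubeLabels K j))) × ι → ℝ),
      lpW d ℓ k 2 (opK (regWt ((ℓ + 1) ^ k) (fineDom ((ℓ + 1) ^ k) (subLabels Ω₀c K j \ (Ωc ∩ cubeLabels K j)))) m2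
            (B1.aSeq a ((ℓ : ℝ) + 1) k * (((((ℓ + 1) ^ k : ℕ)) : ℝ) ^ (d + 1))⁻¹)
            (rBlkWt ((ℓ + 1) ^ k) (subLabels Ω₀c K j \ (Ωc ∩ cubeLabels K j)) (fineDom ((ℓ + 1) ^ k) (subLabels Ω₀c K j \ (Ωc ∩ cubeLabels K j))))
            (fieldLink F κ (acBond (subLabels Ω₀c K j \ (Ωc ∩ cubeLabels K j)) Ac))
            (contourTrans (fieldLink F κ (acBond (subLabels Ω₀c K j \ (Ωc ∩ cubeLabels K j)) Ac)) (rbaseEmb hn (subLabels Ω₀c K j \ (Ωc ∩ cubeLabels K j)))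
              (rstairContour hn (subLabels Ω₀c K j \ (Ωc ∩ cubeLabels K j))))
            (fun a : ↥(fineDom ((ℓ + 1) ^ k) (subLabels Ω₀c K j \ (Ωc ∩ cubeLabels K j))) => hZ ((ℓ + 1) ^ k) K j a.1)
          *ᵥ ((covOp (regWt ((ℓ + 1) ^ k) (fineDom ((ℓ + 1) ^ k) (subLabels Ω₀c K j \ (Ωc ∩ cubeLabels K j)))) m2
                (B1.aSeq a ((ℓ : ℝ) + 1) k * (((((ℓ + 1) ^ k : ℕ)) : ℝ) ^ (d + 1))⁻¹)
                (rBlkWt ((ℓ + 1) ^ k) (subLabels Ω₀c K j \ (Ωc ∩ cubeLabels K j)) (fineDom ((ℓ + 1) ^ k) (subLabels Ω₀c K j \ (Ωc ∩ cubeLabels K j))))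
                (fieldLink F κ (acBond (subLabels Ω₀c K j \ (Ωc ∩ cubeLabels K j)) Ac))
                (contourTrans (fieldLink F κ (acBond (subLabels Ω₀c K j \ (Ωc ∩ cubeLabels K j)) Ac)) (rbaseEmb hn (subLabels Ω₀c K j \ (Ωc ∩ cubeLabels K j)))
                  (rstairContour hn (subLabels Ω₀c K j \ (Ωc ∩ cubeLabels K j)))))⁻¹
            *ᵥ (mulH (ι := ι) (fun a : ↥(fineDom ((ℓ + 1) ^ k) (subLabels Ω₀c K j \ (Ωc ∩ cubeLabels K j))) => hZ ((ℓ + 1) ^ k) K j a.1) *ᵥ Φ))) ≤ cK * lpW d ℓ k 2 Φ)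
    {cD cH : ℝ} (hcD : 0 ≤ cD) (hcH : 0 ≤ cH) (μ : Fin (d + 1))
    (hDG : ∀ j, cubeLabels K j ⊆ Ω₀c → ∀ (ν : Fin (d + 1)) (Φ : ↥(Box d ℓ k fun _ : Fin (d + 1) => 2 * K) × ι → ℝ),
      supN (derivA d F κ ℓ k (fun _ => 2 * K) (boxFld ℓ k K Ac j) ν
        *ᵥ (greenA d F κ ℓ k a m2 (fun _ => 2 * K) (baseEmb hn _) (stairContour hn _) (boxFld ℓ k K Ac j) *ᵥ Φ))
        ≤ cD * supN Φ)
    {α : ℝ} (hα0 : 0 ≤ α) (hα1 : α ≤ 1)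
    (hHG : ∀ j, cubeLabels K j ⊆ Ω₀c → ∀ (a0 a0' : ↥(Box d ℓ k fun _ : Fin (d + 1) => 2 * K)),
      a0.1 + e1 μ ∈ Box d ℓ k (fun _ : Fin (d + 1) => 2 * K) → a0'.1 + e1 μ ∈ Box d ℓ k (fun _ : Fin (d + 1) => 2 * K) →
      a0'.1 ≠ a0.1 → ∀ (lB : List ↥(Box d ℓ k fun _ : Fin (d + 1) => 2 * K)), IsNNChain a0 lB → pathEnd a0 lB = a0' →
      (lB.length : ℝ) ≤ ((d : ℝ) + 1) * supNorm (a0'.1 - a0.1) →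
      ∀ Φ : ↥(Box d ℓ k fun _ : Fin (d + 1) => 2 * K) × ι → ℝ,
      ((((ℓ + 1) ^ k : ℕ) : ℝ) / supNorm (a0'.1 - a0.1)) ^ α *
        siteNorm (transport (fieldLink F κ (boxFld ℓ k K Ac j)) a0 lB
            *ᵥ fld (derivA d F κ ℓ k (fun _ => 2 * K) (boxFld ℓ k K Ac j) μ
              *ᵥ (greenA d F κ ℓ k a m2 (fun _ => 2 * K) (baseEmb hn _) (stairContour hn _) (boxFld ℓ k K Ac j)
                *ᵥ Φ)) a0'
          - fld (derivA d F κ ℓ k (fun _ => 2 * K) (boxFld ℓ k K Ac j) μ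
              *ᵥ (greenA d F κ ℓ k a m2 (fun _ => 2 * K) (baseEmb hn _) (stairContour hn _) (boxFld ℓ k K Ac j)
                *ᵥ Φ)) a0)
        ≤ cH * supN Φ)
    (h3 : (3 : ℝ) ^ (d + 1) * (Real.sqrt (Fintype.card ι) * cK) ≤ Real.exp (-1))
    -- the pair, the bonds, the contour (in `Ω`)
    (x x' : ↥(fineDom ((ℓ + 1) ^ k) Ωc)) (hxμ : x.1 + e1 μ ∈ fineDom ((ℓ + 1) ^ k) Ωc)
    (hx'μ : x'.1 + e1 μ ∈ fineDom ((ℓ + 1) ^ k) Ωc) (hne : x'.1 ≠ x.1)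
    (hclose : 32 * supNorm (x'.1 - x.1) ≤ (((ℓ + 1) ^ k : ℕ) : ℝ) * K)
    (l : List ↥(fineDom ((ℓ + 1) ^ k) Ωc)) (hl : IsNNChain x l) (hlend : pathEnd x l = x')
    (hlen : (l.length : ℝ) ≤ ((d : ℝ) + 1) * supNorm (x'.1 - x.1))
    (hlnear : ∀ z ∈ l, supNorm (z.1 - x.1) ≤ supNorm (x'.1 - x.1))
    (hR₀ : ∀ yl : Fin (d + 1) → ℤ, (∀ ν, |yl ν - blk ((ℓ + 1) ^ k) x.1 ν| ≤ (K : ℤ) * (n₀ + 3)) → yl ∈ Ωc)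
    -- the source and the three separations
    (P : ↥(fineDom ((ℓ + 1) ^ k) Ω₀c) → Prop) [DecidablePred P] {D D₀ D₁ : ℝ}
    (hD : ∀ x'', P x'' → ∃ ν, D ≤ |rpos ((ℓ + 1) ^ k) Ω₀c (incl hn hsub x) ν - rpos ((ℓ + 1) ^ k) Ω₀c x'' ν|)
    (hD₀ : ∀ x₁ : ↥(fineDom ((ℓ + 1) ^ k) Ω₀c), ¬ inReg ((ℓ + 1) ^ k) Ωc x₁ →
      ∃ ν, D₀ ≤ |rpos ((ℓ + 1) ^ k) Ω₀c (incl hn hsub x) ν - rpos ((ℓ + 1) ^ k) Ω₀c x₁ ν|)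
    (hD₁ : ∀ x'', P x'' → ∀ x₁ : ↥(fineDom ((ℓ + 1) ^ k) Ω₀c), ¬ inReg ((ℓ + 1) ^ k) Ωc x₁ →
      ∃ ν, D₁ ≤ |rpos ((ℓ + 1) ^ k) Ω₀c x₁ ν - rpos ((ℓ + 1) ^ k) Ω₀c x'' ν|)
    (f : ↥(fineDom ((ℓ + 1) ^ k) Ω₀c) × ι → ℝ) (hfP : ∀ p, ¬ P p.1 → f p = 0) {V : ℝ} (hV : 1 ≤ V)
    (hfV : lpv (vol d ℓ k)⁻¹ 2 f ≤ V * ‖f‖) (i : ι) :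
    ((((ℓ + 1) ^ k : ℕ) : ℝ) / supNorm (x'.1 - x.1)) ^ α *
      |(transport (fieldLink F κ (acBond Ωc Ac)) x l
          *ᵥ fld (covDeriv ((ℓ + 1) ^ k) (fineDom ((ℓ + 1) ^ k) Ωc) (fieldLink F κ (acBond Ωc Ac)) μ
            *ᵥ ((regOp F κ hn Ωc m2 (B1.aSeq a ((ℓ : ℝ) + 1) k * (((((ℓ + 1) ^ k : ℕ)) : ℝ) ^ (d + 1))⁻¹) (compField Ac))⁻¹
              *ᵥ (fun q : ↥(fineDom ((ℓ + 1) ^ k) Ωc) × ι => f (incl hn hsub q.1, q.2)))) x'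
        - fld (covDeriv ((ℓ + 1) ^ k) (fineDom ((ℓ + 1) ^ k) Ωc) (fieldLink F κ (acBond Ωc Ac)) μ
            *ᵥ ((regOp F κ hn Ωc m2 (B1.aSeq a ((ℓ : ℝ) + 1) k * (((((ℓ + 1) ^ k : ℕ)) : ℝ) ^ (d + 1))⁻¹) (compField Ac))⁻¹
              *ᵥ (fun q : ↥(fineDom ((ℓ + 1) ^ k) Ωc) × ι => f (incl hn hsub q.1, q.2)))) x
        - (transport (fieldLink F κ (acBond Ωc Ac)) x l
            *ᵥ fld (covDeriv ((ℓ + 1) ^ k) (fineDom ((ℓ + 1) ^ k) Ω₀c) (fieldLink F κ (acBond Ω₀c Ac)) μ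
              *ᵥ ((covOp (regWt ((ℓ + 1) ^ k) (fineDom ((ℓ + 1) ^ k) Ω₀c)) m2
                (B1.aSeq a ((ℓ : ℝ) + 1) k * (((((ℓ + 1) ^ k : ℕ)) : ℝ) ^ (d + 1))⁻¹)
                (rBlkWt ((ℓ + 1) ^ k) Ω₀c (fineDom ((ℓ + 1) ^ k) Ω₀c)) (fieldLink F κ (acBond Ω₀c Ac))
                (contourTrans (fieldLink F κ (acBond Ω₀c Ac)) (rbaseEmb hn Ω₀c) (rstairContour hn Ω₀c)))⁻¹ *ᵥ f)) (incl hn hsub x')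
          - fld (covDeriv ((ℓ + 1) ^ k) (fineDom ((ℓ + 1) ^ k) Ω₀c) (fieldLink F κ (acBond Ω₀c Ac)) μ
              *ᵥ ((covOp (regWt ((ℓ + 1) ^ k) (fineDom ((ℓ + 1) ^ k) Ω₀c)) m2
                (B1.aSeq a ((ℓ : ℝ) + 1) k * (((((ℓ + 1) ^ k : ℕ)) : ℝ) ^ (d + 1))⁻¹)
                (rBlkWt ((ℓ + 1) ^ k) Ω₀c (fineDom ((ℓ + 1) ^ k) Ω₀c)) (fieldLink F κ (acBond Ω₀c Ac))
                (contourTrans (fieldLink F κ (acBond Ω₀c Ac)) (rbaseEmb hn Ω₀c) (rstairContour hn Ω₀c)))⁻¹ *ᵥ f)) (incl hn hsub x))) i|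
      ≤ 2 ^ (d + 5) * Real.exp (9 / 2)
          * (Real.sqrt (Fintype.card ι) * (cH + ((d : ℝ) + 1) * D1 hprof * cD
              + ((d : ℝ) + 3) * (((d : ℝ) + 1) * (D1 hprof + D2 hprof)) * cD
              + ((d : ℝ) + 1) * (D1 hprof ^ 2 + D2 hprof) * cG))
          * V * Real.exp (-((D + D₀ + D₁) / (2 * (((((ℓ + 1) ^ k : ℕ)) : ℝ) * K)))) * ‖f‖ := by
  classical
  -- scalars
  have hK8 : 8 ≤ K := le_trans (by norm_num) hK16
  have hK1 : 1 ≤ K := le_trans (by norm_num) hK16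
  have hn2 : 2 ≤ (ℓ + 1) ^ k := by
    calc 2 ≤ ℓ + 1 := by omega
      _ = (ℓ + 1) ^ 1 := (pow_one _).symm
      _ ≤ (ℓ + 1) ^ k := Nat.pow_le_pow_right (Nat.succ_pos ℓ) hk
  have hnK3 : 3 ≤ (ℓ + 1) ^ k * K := le_trans (by norm_num) (Nat.mul_le_mul hn2 hK8)
  have hnr1 : (1 : ℝ) ≤ ((((ℓ + 1) ^ k : ℕ)) : ℝ) := by exact_mod_cast hn
  have hnr : (0 : ℝ) < ((((ℓ + 1) ^ k : ℕ)) : ℝ) := by linarith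
  have hKr : (1 : ℝ) ≤ K := by exact_mod_cast hK1
  have hK16r : (16 : ℝ) ≤ K := by exact_mod_cast hK16
  have hKpos : (0 : ℝ) < K := by positivity
  have hM : (0 : ℝ) < ((((ℓ + 1) ^ k : ℕ)) : ℝ) * K := by positivity
  have hL : (1 : ℝ) < (ℓ : ℝ) + 1 := by
    have : (1 : ℝ) ≤ ℓ := by exact_mod_cast hℓ
    linarith
  have hak : 0 < B1.aSeq a ((ℓ : ℝ) + 1) k := B1.aSeq_pos ha hL hk
  have hak' : 0 < B1.aSeq a ((ℓ : ℝ) + 1) k * (((((ℓ + 1) ^ k : ℕ)) : ℝ) ^ (d + 1))⁻¹ := by positivity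
  have hw : (0 : ℝ) < (vol d ℓ k)⁻¹ := inv_pos.2 (vol_pos d ℓ k)
  have hN : (0 : ℝ) ≤ Real.sqrt (Fintype.card ι) := Real.sqrt_nonneg _
  have hD1 := D1_nonneg contDiff_hprof hasCompactSupport_hprof
  have hD2 := D2_nonneg contDiff_hprof hasCompactSupport_hprof
  -- the four chain inputs of the first family on `Ω₀`, the support of `h_j`
  obtain ⟨-, H0, Hgr, H2⟩ := chain_letter_inputs F κ hℓ hk hn Ω₀c hK8 ha hm Ac hcG hcK hn₀ hG h0 h1 hg hb
  have hsupp : ∀ (j : Fin (d + 1) → ℤ) (z : ↥(fineDom ((ℓ + 1) ^ k) Ω₀c)),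
      hCube (((((ℓ + 1) ^ k : ℕ)) : ℝ) * K) j (rpos ((ℓ + 1) ^ k) Ω₀c z) ≠ 0 → cubeS ℓ k Ω₀c K j z :=
    fun j z hz => cubeS_of_hCube_ne_zero ℓ k Ω₀c hK1 j z hz
  have heI : ∀ j : Fin (d + 1) → ℤ, Function.Injective (incl hn (subLabels_subset Ω₀c K j)) :=
    fun j => incl_injective hn _
  have hgood₀ : ∀ {j : Fin (d + 1) → ℤ}, cubeLabels K j ⊆ Ωc → cubeLabels K j ⊆ Ω₀c := fun h => h.trans hsub
  -- the Hölder weight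
  set r : ℝ := supNorm (x'.1 - x.1) with hr_def
  have hr1 : 1 ≤ r := one_le_supNorm_of_ne hne
  have hr0 : 0 ≤ r := by linarith
  have hrK : r ≤ ((((ℓ + 1) ^ k : ℕ)) : ℝ) * K := by linarith
  set w : ℝ := (((((ℓ + 1) ^ k : ℕ)) : ℝ) / r) ^ α with hw_def
  have hw0 : 0 ≤ w := Real.rpow_nonneg (div_nonneg hnr.le hr0) α
  -- the points of `Ω` and their images on the sites of `Ω₀`, the contour read on `Ω₀`
  have hxxμ : (incl hn hsub x).1 + e1 μ ∈ fineDom ((ℓ + 1) ^ k) Ω₀c := fineDom_mono hn hsub hxμ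
  have hxx'μ : (incl hn hsub x').1 + e1 μ ∈ fineDom ((ℓ + 1) ^ k) Ω₀c := fineDom_mono hn hsub hx'μ
  set ll : List ↥(fineDom ((ℓ + 1) ^ k) Ω₀c) := l.map (incl hn hsub) with hll_def
  have hll : IsNNChain (incl hn hsub x) ll := (isNNChain_map_incl hn hsub x l hl).1
  have hllend : pathEnd (incl hn hsub x) ll = (incl hn hsub x') := by rw [hll_def, (isNNChain_map_incl hn hsub x l hl).2, hlend]
  have hlllen : (ll.length : ℝ) ≤ ((d : ℝ) + 1) * supNorm ((incl hn hsub x').1 - (incl hn hsub x).1) := by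
    rw [hll_def, List.length_map]; exact hlen
  have hne' : (incl hn hsub x').1 ≠ (incl hn hsub x).1 := hne
  set hh : (Fin (d + 1) → ℤ) → ↥(fineDom ((ℓ + 1) ^ k) Ω₀c) → ℝ :=
    fun j z => hCube (((((ℓ + 1) ^ k : ℕ)) : ℝ) * K) j (rpos ((ℓ + 1) ^ k) Ω₀c z) with hhh
  -- integer distances to `x`: every relevant point is within `r + 1`
  have dx : ∀ ν, |(((incl hn hsub x).1 ν : ℤ) : ℝ) - x.1 ν| ≤ r + 1 := fun ν => by
    show |((x.1 ν : ℤ) : ℝ) - x.1 ν| ≤ r + 1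
    rw [sub_self, abs_zero]; linarith
  have dy : ∀ ν, |(((incl hn hsub ⟨x.1 + e1 μ, hxμ⟩).1 ν : ℤ) : ℝ) - x.1 ν| ≤ r + 1 := fun ν => by
    show |(((x.1 + e1 μ) ν : ℤ) : ℝ) - x.1 ν| ≤ r + 1
    simp only [Pi.add_apply, Int.cast_add, add_sub_cancel_left]
    exact (abs_e1_cast_le μ ν).trans (by linarith)
  have dx' : ∀ ν, |(((incl hn hsub x').1 ν : ℤ) : ℝ) - x.1 ν| ≤ r + 1 := fun ν => by
    show |((x'.1 ν : ℤ) : ℝ) - x.1 ν| ≤ r + 1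
    have h := abs_le_supNorm (x'.1 - x.1) ν
    rw [Pi.sub_apply, Int.cast_abs, Int.cast_sub] at h
    exact h.trans (by linarith)
  have dy' : ∀ ν, |(((incl hn hsub ⟨x'.1 + e1 μ, hx'μ⟩).1 ν : ℤ) : ℝ) - x.1 ν| ≤ r + 1 := fun ν => by
    show |(((x'.1 + e1 μ) ν : ℤ) : ℝ) - x.1 ν| ≤ r + 1
    simp only [Pi.add_apply, Int.cast_add]
    have h := abs_le_supNorm (x'.1 - x.1) ν
    rw [Pi.sub_apply, Int.cast_abs, Int.cast_sub] at h
    calc |((x'.1 ν : ℤ) : ℝ) + ((e1 μ ν : ℤ) : ℝ) - x.1 ν| = |(((x'.1 ν : ℤ) : ℝ) - x.1 ν) + ((e1 μ ν : ℤ) : ℝ)| := by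
          ring_nf
      _ ≤ |((x'.1 ν : ℤ) : ℝ) - x.1 ν| + |((e1 μ ν : ℤ) : ℝ)| := abs_add_le _ _
      _ ≤ r + 1 := add_le_add h (abs_e1_cast_le μ ν)
  have dl : ∀ z ∈ ll, ∀ ν, |((z.1 ν : ℤ) : ℝ) - x.1 ν| ≤ r + 1 := fun z hz ν => by
    obtain ⟨z₀, hz₀, rfl⟩ := List.mem_map.1 hz
    show |((z₀.1 ν : ℤ) : ℝ) - x.1 ν| ≤ r + 1
    have h := abs_le_supNorm (z₀.1 - x.1) ν
    rw [Pi.sub_apply, Int.cast_abs, Int.cast_sub] at h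
    exact h.trans ((hlnear z₀ hz₀).trans (by linarith))
  -- pairs of relevant points are within `M/8`
  have hclose' : 2 * r + 2 ≤ 1 / 8 * (((((ℓ + 1) ^ k : ℕ)) : ℝ) * K) := by nlinarith
  have hpair : ∀ (p q : ↥(fineDom ((ℓ + 1) ^ k) Ω₀c)), (∀ ν, |((p.1 ν : ℤ) : ℝ) - x.1 ν| ≤ r + 1) →
      (∀ ν, |((q.1 ν : ℤ) : ℝ) - x.1 ν| ≤ r + 1) →
      ∀ ν, |rpos ((ℓ + 1) ^ k) Ω₀c q ν - rpos ((ℓ + 1) ^ k) Ω₀c p ν| ≤ 1 / 8 * (((((ℓ + 1) ^ k : ℕ)) : ℝ) * K) := by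
    intro p q hp hq ν
    show |((q.1 ν : ℤ) : ℝ) - ((p.1 ν : ℤ) : ℝ)| ≤ _
    calc |((q.1 ν : ℤ) : ℝ) - p.1 ν| = |(((q.1 ν : ℤ) : ℝ) - x.1 ν) - (((p.1 ν : ℤ) : ℝ) - x.1 ν)| := by ring_nf
      _ ≤ |((q.1 ν : ℤ) : ℝ) - x.1 ν| + |((p.1 ν : ℤ) : ℝ) - x.1 ν| := abs_sub _ _
      _ ≤ 2 * r + 2 := by linarith [hp ν, hq ν]
      _ ≤ 1 / 8 * (((((ℓ + 1) ^ k : ℕ)) : ℝ) * K) := hclose'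
  have hxy : ∀ ν, |rpos ((ℓ + 1) ^ k) Ω₀c (incl hn hsub x) ν - rpos ((ℓ + 1) ^ k) Ω₀c (incl hn hsub ⟨x.1 + e1 μ, hxμ⟩) ν| ≤ 1 / 8 * (((((ℓ + 1) ^ k : ℕ)) : ℝ) * K) :=
    hpair (incl hn hsub ⟨x.1 + e1 μ, hxμ⟩) (incl hn hsub x) dy dx
  have hxx'8 : ∀ ν, |rpos ((ℓ + 1) ^ k) Ω₀c (incl hn hsub x) ν - rpos ((ℓ + 1) ^ k) Ω₀c (incl hn hsub x') ν| ≤ 1 / 8 * (((((ℓ + 1) ^ k : ℕ)) : ℝ) * K) :=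
    hpair (incl hn hsub x') (incl hn hsub x) dx' dx
  have hx'y' : ∀ ν, |rpos ((ℓ + 1) ^ k) Ω₀c (incl hn hsub x') ν - rpos ((ℓ + 1) ^ k) Ω₀c (incl hn hsub ⟨x'.1 + e1 μ, hx'μ⟩) ν| ≤ 1 / 8 * (((((ℓ + 1) ^ k : ℕ)) : ℝ) * K) :=
    hpair (incl hn hsub ⟨x'.1 + e1 μ, hx'μ⟩) (incl hn hsub x') dy' dx'
  -- the per-cube Hölder input, first family read as `Ω₀`'s `atGreen` at a cube interior to `Ω`
  set γH : ℝ := Real.sqrt (Fintype.card ι) * (cH + ((d : ℝ) + 1) * D1 hprof * cD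
      + ((d : ℝ) + 3) * (((d : ℝ) + 1) * (D1 hprof + D2 hprof)) * cD
      + ((d : ℝ) + 1) * (D1 hprof ^ 2 + D2 hprof) * cG) with hγH_def
  have hγH0 : 0 ≤ γH := by rw [hγH_def]; positivity
  have hγH' : ∀ jj : ↥(labels (((((ℓ + 1) ^ k : ℕ)) : ℝ) * K) ((ℓ + 1) ^ k) Ω₀c), cubeLabels K jj.1 ⊆ Ωc →
      ‖((((((ℓ + 1) ^ k : ℕ)) : ℝ) * w) • (unitOp (incl hn hsub x) (incl hn hsub ⟨x'.1 + e1 μ, hx'μ⟩) ((transport (fieldLink F κ (acBond Ω₀c Ac)) (incl hn hsub x) ll) * (fieldLink F κ (acBond Ω₀c Ac)) (incl hn hsub x') (incl hn hsub ⟨x'.1 + e1 μ, hx'μ⟩))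
          - unitOp (incl hn hsub x) (incl hn hsub x') (transport (fieldLink F κ (acBond Ω₀c Ac)) (incl hn hsub x) ll) - (unitOp (incl hn hsub x) (incl hn hsub ⟨x.1 + e1 μ, hxμ⟩) ((fieldLink F κ (acBond Ω₀c Ac)) (incl hn hsub x) (incl hn hsub ⟨x.1 + e1 μ, hxμ⟩)) - unitOp (incl hn hsub x) (incl hn hsub x) 1)))
        * (mulH (ι := ι) (hh jj.1) * atGreen F κ ℓ k Ω₀c K Ac a m2 jj.1 * mulH (ι := ι) (hh jj.1))‖ ≤ γH := by
    intro jj hgj'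
    have hgj := hgood₀ hgj'
    by_cases hzero : hh jj.1 (incl hn hsub x) = 0 ∧ hh jj.1 (incl hn hsub ⟨x.1 + e1 μ, hxμ⟩) = 0 ∧ hh jj.1 (incl hn hsub x') = 0 ∧ hh jj.1 (incl hn hsub ⟨x'.1 + e1 μ, hx'μ⟩) = 0
    · obtain ⟨e1', e2', e3', e4'⟩ := hzero
      rw [← Matrix.mul_assoc, ← Matrix.mul_assoc, holderOp_mul_mulH, e1', e2', e3', e4']
      simp only [zero_smul, sub_self, smul_zero, Matrix.zero_mul, norm_zero]
      exact hγH0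
    · have hseen : ∃ p : ↥(fineDom ((ℓ + 1) ^ k) Ω₀c), hh jj.1 p ≠ 0 ∧ ∀ ν, |((p.1 ν : ℤ) : ℝ) - x.1 ν| ≤ r + 1 := by
        by_cases a1 : hh jj.1 (incl hn hsub x) = 0
        · by_cases a2 : hh jj.1 (incl hn hsub ⟨x.1 + e1 μ, hxμ⟩) = 0
          · by_cases a3 : hh jj.1 (incl hn hsub x') = 0
            · have a4 : hh jj.1 (incl hn hsub ⟨x'.1 + e1 μ, hx'μ⟩) ≠ 0 := fun a4 => hzero ⟨a1, a2, a3, a4⟩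
              exact ⟨(incl hn hsub ⟨x'.1 + e1 μ, hx'μ⟩), a4, dy'⟩
            · exact ⟨(incl hn hsub x'), a3, dx'⟩
          · exact ⟨(incl hn hsub ⟨x.1 + e1 μ, hxμ⟩), a2, dy⟩
        · exact ⟨(incl hn hsub x), a1, dx⟩
      obtain ⟨p, hp, dp⟩ := hseen
      have hpl : ∀ q : ↥(fineDom ((ℓ + 1) ^ k) Ω₀c), (∀ ν, |((q.1 ν : ℤ) : ℝ) - x.1 ν| ≤ r + 1) →
          ∀ ν, |rpos ((ℓ + 1) ^ k) Ω₀c q ν - (((((ℓ + 1) ^ k : ℕ)) : ℝ) * K) * jj.1 ν| ≤ 3 / 4 * (((((ℓ + 1) ^ k : ℕ)) : ℝ) * K) := by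
        intro q hq ν
        have h1 := hCube_ne_zero_imp hM hp ν
        have h2 := hpair p q dp hq ν
        calc |rpos ((ℓ + 1) ^ k) Ω₀c q ν - (((((ℓ + 1) ^ k : ℕ)) : ℝ) * K) * jj.1 ν|
            ≤ |rpos ((ℓ + 1) ^ k) Ω₀c q ν - rpos ((ℓ + 1) ^ k) Ω₀c p ν|
              + |rpos ((ℓ + 1) ^ k) Ω₀c p ν - (((((ℓ + 1) ^ k : ℕ)) : ℝ) * K) * jj.1 ν| := abs_sub_le _ _ _
          _ ≤ 1 / 8 * (((((ℓ + 1) ^ k : ℕ)) : ℝ) * K) + 5 / 8 * (((((ℓ + 1) ^ k : ℕ)) : ℝ) * K) := add_le_add h2 h1.le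
          _ = 3 / 4 * (((((ℓ + 1) ^ k : ℕ)) : ℝ) * K) := by ring
      have hE := boxEmb_injective ℓ k (fun _ => 2 * K) (cshift K jj.1) (shift_mem_of_cube_subset hgj)
      have hpre : ∀ q : ↥(fineDom ((ℓ + 1) ^ k) Ω₀c), (∀ ν, |((q.1 ν : ℤ) : ℝ) - x.1 ν| ≤ r + 1) →
          ∃ c, boxEmb ℓ k (fun _ => 2 * K) (cshift K jj.1) (shift_mem_of_cube_subset hgj) c = q :=
        fun q hq => (cubeS_iff_boxEmb ℓ k Ω₀c K hgj q).1 (cubeS_of_core ℓ k Ω₀c hK1 jj.1 q (hpl q hq))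
      obtain ⟨a0, ha0⟩ := hpre (incl hn hsub x) dx
      obtain ⟨b0, hb0⟩ := hpre (incl hn hsub ⟨x.1 + e1 μ, hxμ⟩) dy
      obtain ⟨lB, hlB, hchB, hendB, hlenB⟩ := exists_chain_preimage ℓ k (fun _ => 2 * K) (cshift K jj.1)
        (shift_mem_of_cube_subset hgj) (incl hn hsub x) ll a0 ha0 hll fun z hz => hpre z (dl z hz)
      set a0' := pathEnd a0 lB with ha0'_def
      have ha0' : boxEmb ℓ k (fun _ => 2 * K) (cshift K jj.1) (shift_mem_of_cube_subset hgj) a0' = (incl hn hsub x') := by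
        rw [ha0'_def, hendB, hllend]
      obtain ⟨b0', hb0'⟩ := hpre (incl hn hsub ⟨x'.1 + e1 μ, hx'μ⟩) dy'
      have hshift : ∀ (c c' : ↥(Box d ℓ k fun _ : Fin (d + 1) => 2 * K)) (z z' : ↥(fineDom ((ℓ + 1) ^ k) Ω₀c)),
          boxEmb ℓ k (fun _ => 2 * K) (cshift K jj.1) (shift_mem_of_cube_subset hgj) c = z →
          boxEmb ℓ k (fun _ => 2 * K) (cshift K jj.1) (shift_mem_of_cube_subset hgj) c' = z' →
          z'.1 = z.1 + e1 μ → c'.1 = c.1 + e1 μ := by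
        intro c c' z z' hc hc' hzz'
        have h1 : c'.1 + (fun i => (((ℓ + 1) ^ k : ℕ) : ℤ) * cshift K jj.1 i) = z'.1 := congrArg Subtype.val hc'
        have h2 : c.1 + (fun i => (((ℓ + 1) ^ k : ℕ) : ℤ) * cshift K jj.1 i) = z.1 := congrArg Subtype.val hc
        have h3 : c'.1 + (fun i => (((ℓ + 1) ^ k : ℕ) : ℤ) * cshift K jj.1 i)
            = (c.1 + e1 μ) + (fun i => (((ℓ + 1) ^ k : ℕ) : ℤ) * cshift K jj.1 i) := by
          rw [h1, hzz', ← h2]; abel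
        exact add_right_cancel h3
      have hba : b0.1 = a0.1 + e1 μ := hshift a0 b0 (incl hn hsub x) (incl hn hsub ⟨x.1 + e1 μ, hxμ⟩) ha0 hb0 rfl
      have hba' : b0'.1 = a0'.1 + e1 μ := hshift a0' b0' (incl hn hsub x') (incl hn hsub ⟨x'.1 + e1 μ, hx'μ⟩) ha0' hb0' rfl
      have ha0μ : a0.1 + e1 μ ∈ Box d ℓ k (fun _ : Fin (d + 1) => 2 * K) := hba ▸ b0.2
      have ha0'μ : a0'.1 + e1 μ ∈ Box d ℓ k (fun _ : Fin (d + 1) => 2 * K) := hba' ▸ b0'.2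
      have hyB : boxEmb ℓ k (fun _ => 2 * K) (cshift K jj.1) (shift_mem_of_cube_subset hgj) ⟨a0.1 + e1 μ, ha0μ⟩ = (incl hn hsub ⟨x.1 + e1 μ, hxμ⟩) := by
        rw [← hb0]; congr 1; exact Subtype.ext hba.symm
      have hy'B : boxEmb ℓ k (fun _ => 2 * K) (cshift K jj.1) (shift_mem_of_cube_subset hgj) ⟨a0'.1 + e1 μ, ha0'μ⟩
          = (incl hn hsub ⟨x'.1 + e1 μ, hx'μ⟩) := by
        rw [← hb0']; congr 1; exact Subtype.ext hba'.symm
      have hsubB : a0'.1 - a0.1 = (incl hn hsub x').1 - (incl hn hsub x).1 := by rw [← ha0, ← ha0', boxEmb_sub_boxEmb]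
      have hneB : a0'.1 ≠ a0.1 := fun h => hne' (by
        have h2 := hsubB
        rw [h, sub_self] at h2
        exact (sub_eq_zero.mp h2.symm))
      have hlenB' : (lB.length : ℝ) ≤ ((d : ℝ) + 1) * supNorm (a0'.1 - a0.1) := by rw [hlenB, hsubB]; exact hlllen
      have hcore : ∀ z : ↥(fineDom ((ℓ + 1) ^ k) Ω₀c), (z = (incl hn hsub x) ∨ z = (incl hn hsub ⟨x.1 + e1 μ, hxμ⟩) ∨ z = (incl hn hsub x') ∨ z = (incl hn hsub ⟨x'.1 + e1 μ, hx'μ⟩) ∨ z ∈ ll) →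
          ∀ ν, |rpos ((ℓ + 1) ^ k) Ω₀c z ν - (((((ℓ + 1) ^ k : ℕ)) : ℝ) * K) * jj.1 ν| ≤ 3 / 4 * (((((ℓ + 1) ^ k : ℕ)) : ℝ) * K) := by
        intro z hz
        rcases hz with rfl | rfl | rfl | rfl | hz
        · exact hpl _ dx
        · exact hpl _ dy
        · exact hpl _ dx'
        · exact hpl _ dy'
        · exact hpl _ (dl z hz)
      exact holder_letter_region F κ hn Ω₀c hK1 hnK3 Ac a m2 hgj hcG hcD hcH (hG jj.1 hgj) (hDG jj.1 hgj) μ a0 a0'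
        ha0μ ha0'μ hneB lB hchB rfl hlenB' hα0 hα1
        (hHG jj.1 hgj a0 a0' ha0μ ha0'μ hneB lB hchB rfl hlenB') (incl hn hsub x) (incl hn hsub ⟨x.1 + e1 μ, hxμ⟩) (incl hn hsub x') (incl hn hsub ⟨x'.1 + e1 μ, hx'μ⟩) ll ha0 hyB ha0' hy'B hlB hrK hcore
  have hγH₂ : ∀ jj : ↥(labels (((((ℓ + 1) ^ k : ℕ)) : ℝ) * K) ((ℓ + 1) ^ k) Ω₀c), cubeLabels K jj.1 ⊆ Ωc →
      ‖((((((ℓ + 1) ^ k : ℕ)) : ℝ) * w) • (unitOp (incl hn hsub x) (incl hn hsub ⟨x'.1 + e1 μ, hx'μ⟩) ((transport (fieldLink F κ (acBond Ω₀c Ac)) (incl hn hsub x) ll) * (fieldLink F κ (acBond Ω₀c Ac)) (incl hn hsub x') (incl hn hsub ⟨x'.1 + e1 μ, hx'μ⟩))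
          - unitOp (incl hn hsub x) (incl hn hsub x') (transport (fieldLink F κ (acBond Ω₀c Ac)) (incl hn hsub x) ll) - (unitOp (incl hn hsub x) (incl hn hsub ⟨x.1 + e1 μ, hxμ⟩) ((fieldLink F κ (acBond Ω₀c Ac)) (incl hn hsub x) (incl hn hsub ⟨x.1 + e1 μ, hxμ⟩)) - unitOp (incl hn hsub x) (incl hn hsub x) 1)))
        * (mulH (ι := ι) (hh jj.1) * atGreen₂ F κ ℓ k Ω₀c Ωc hsub K Ac a m2 jj.1 * mulH (ι := ι) (hh jj.1))‖ ≤ γH := by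
    intro jj hgj
    rw [atGreen₂_good F κ ℓ k Ω₀c Ωc hsub K Ac a m2 hgj]
    exact hγH' jj hgj
  have hγHΩ : ∀ jj : ↥(labels (((((ℓ + 1) ^ k : ℕ)) : ℝ) * K) ((ℓ + 1) ^ k) Ω₀c), cubeLabels K jj.1 ⊆ Ωc →
      ‖((((((ℓ + 1) ^ k : ℕ)) : ℝ) * w) • (unitOp (incl hn hsub x) (incl hn hsub ⟨x'.1 + e1 μ, hx'μ⟩) ((transport (fieldLink F κ (acBond Ω₀c Ac)) (incl hn hsub x) ll) * (fieldLink F κ (acBond Ω₀c Ac)) (incl hn hsub x') (incl hn hsub ⟨x'.1 + e1 μ, hx'μ⟩))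
          - unitOp (incl hn hsub x) (incl hn hsub x') (transport (fieldLink F κ (acBond Ω₀c Ac)) (incl hn hsub x) ll) - (unitOp (incl hn hsub x) (incl hn hsub ⟨x.1 + e1 μ, hxμ⟩) ((fieldLink F κ (acBond Ω₀c Ac)) (incl hn hsub x) (incl hn hsub ⟨x.1 + e1 μ, hxμ⟩)) - unitOp (incl hn hsub x) (incl hn hsub x) 1)))
        * (mulH (ι := ι) (hh jj.1) * atGreenΩ F κ ℓ k Ω₀c Ωc hsub K Ac a m2 jj.1 * mulH (ι := ι) (hh jj.1))‖ ≤ γH := by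
    intro jj hgj
    rw [letterΩ_a_eq F κ ℓ k Ω₀c Ωc hsub K Ac a m2 hgj _ (hsupp jj.1)]
    exact hγH' jj hgj
  -- the letters of both families (as in the value member)
  have hL2 : ∀ {j : Fin (d + 1) → ℤ} (hj : cubeLabels K j ⊆ Ωc),
      opK (cutWt (cubeS ℓ k Ω₀c K j) (regWt ((ℓ + 1) ^ k) (fineDom ((ℓ + 1) ^ k) Ω₀c))) m2
          (B1.aSeq a ((ℓ : ℝ) + 1) k * (((((ℓ + 1) ^ k : ℕ)) : ℝ) ^ (d + 1))⁻¹)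
          (rBlkWt ((ℓ + 1) ^ k) Ω₀c (fineDom ((ℓ + 1) ^ k) Ω₀c))
          (cubeW F κ ℓ k Ω₀c K (atField₂ ℓ k Ω₀c Ωc K Ac j) j) (cubeT F κ ℓ k Ω₀c K (atField₂ ℓ k Ω₀c Ωc K Ac j) j)
          (hh j) * atGreen₂ F κ ℓ k Ω₀c Ωc hsub K Ac a m2 j * mulH (ι := ι) (hh j)
      = chainLetter F κ ℓ k Ω₀c K Ac a m2 j := by
    intro j hj
    dsimp only [chainLetter]
    rw [atField₂_good ℓ k Ω₀c Ωc K Ac hj, atGreen₂_good F κ ℓ k Ω₀c Ωc hsub K Ac a m2 hj]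
  have hLΩ : ∀ {j : Fin (d + 1) → ℤ} (hj : cubeLabels K j ⊆ Ωc),
      opK (cutWt (cubeS ℓ k Ω₀c K j) (cOmega ℓ k Ω₀c Ωc)) m2
          (B1.aSeq a ((ℓ : ℝ) + 1) k * (((((ℓ + 1) ^ k : ℕ)) : ℝ) ^ (d + 1))⁻¹)
          (rBlkWt ((ℓ + 1) ^ k) Ω₀c (fineDom ((ℓ + 1) ^ k) Ω₀c))
          (cubeW F κ ℓ k Ω₀c K (atField₂ ℓ k Ω₀c Ωc K Ac j) j) (cubeT F κ ℓ k Ω₀c K (atField₂ ℓ k Ω₀c Ωc K Ac j) j)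
          (hh j) * atGreenΩ F κ ℓ k Ω₀c Ωc hsub K Ac a m2 j * mulH (ι := ι) (hh j)
      = chainLetter F κ ℓ k Ω₀c K Ac a m2 j := by
    intro j hj
    dsimp only [chainLetter]
    exact letterΩ_b_eq F κ ℓ k Ω₀c Ωc hsub K Ac a m2 hj _ (hsupp j)
  have hLI : ∀ {j : Fin (d + 1) → ℤ} (hj : ¬ cubeLabels K j ⊆ Ωc) (g : ↥(fineDom ((ℓ + 1) ^ k) Ω₀c) × ι → ℝ),
      lpv (vol d ℓ k)⁻¹ 2 ((opK (cutWt (cubeS ℓ k Ω₀c K j) (regWt ((ℓ + 1) ^ k) (fineDom ((ℓ + 1) ^ k) Ω₀c))) m2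
          (B1.aSeq a ((ℓ : ℝ) + 1) k * (((((ℓ + 1) ^ k : ℕ)) : ℝ) ^ (d + 1))⁻¹)
          (rBlkWt ((ℓ + 1) ^ k) Ω₀c (fineDom ((ℓ + 1) ^ k) Ω₀c))
          (cubeW F κ ℓ k Ω₀c K (atField₂ ℓ k Ω₀c Ωc K Ac j) j) (cubeT F κ ℓ k Ω₀c K (atField₂ ℓ k Ω₀c Ωc K Ac j) j)
          (hh j) * atGreen₂ F κ ℓ k Ω₀c Ωc hsub K Ac a m2 j * mulH (ι := ι) (hh j)) *ᵥ g)
      ≤ Real.sqrt (Fintype.card ι) * cK * lpv (vol d ℓ k)⁻¹ 2 g := by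
    intro j hj g
    rw [atField₂_bad ℓ k Ω₀c Ωc K Ac hj, atGreen₂_bad F κ ℓ k Ω₀c Ωc hsub K Ac a m2 hj,
      cube_letter_b_I F κ ℓ k Ω₀c K m2 _ _ j _ (hsupp j), hCube_incl ℓ k Ω₀c K j, lpv_pad_mulVec (heI j) two_pos]
    have hin := hb j (fun q : ↥(fineDom ((ℓ + 1) ^ k) (subLabels Ω₀c K j)) × ι =>
      g (incl hn (subLabels_subset Ω₀c K j) q.1, q.2))
    rw [Matrix.mulVec_mulVec, Matrix.mulVec_mulVec] at hin
    refine (lpv_bound_of_lpW_bound d ℓ k two_pos le_rfl hcK hin).trans ?_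
    exact mul_le_mul_of_nonneg_left (lpv_res_le (heI j) hw.le two_pos g) (by positivity)
  -- `R₀`: the cubes seeing one of the four points and their `n₀`-neighbours are interior to `Ω`
  have hblk : ∀ p : ↥(fineDom ((ℓ + 1) ^ k) Ωc), (∀ ν, |((p.1 ν : ℤ) : ℝ) - x.1 ν| ≤ r + 1) →
      ∀ ν, |blk ((ℓ + 1) ^ k) p.1 ν - blk ((ℓ + 1) ^ k) x.1 ν| ≤ (K : ℤ) := by
    intro p hp ν
    refine abs_blk_sub_blk_le hn ν ?_
    rw [Int.cast_abs, Int.cast_sub]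
    exact (hp ν).trans (by linarith)
  have hRp : ∀ p : ↥(fineDom ((ℓ + 1) ^ k) Ωc), (∀ ν, |((p.1 ν : ℤ) : ℝ) - x.1 ν| ≤ r + 1) →
      ∀ y'' : Fin (d + 1) → ℤ, (∀ ν, |y'' ν - blk ((ℓ + 1) ^ k) p.1 ν| ≤ (K : ℤ) * (n₀ + 2)) → y'' ∈ Ωc := by
    intro p hp y'' hy''
    refine hR₀ y'' fun ν => ?_
    calc |y'' ν - blk ((ℓ + 1) ^ k) x.1 ν|
        = |(y'' ν - blk ((ℓ + 1) ^ k) p.1 ν) + (blk ((ℓ + 1) ^ k) p.1 ν - blk ((ℓ + 1) ^ k) x.1 ν)| := by ring_nf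
      _ ≤ |y'' ν - blk ((ℓ + 1) ^ k) p.1 ν| + |blk ((ℓ + 1) ^ k) p.1 ν - blk ((ℓ + 1) ^ k) x.1 ν| := abs_add_le _ _
      _ ≤ (K : ℤ) * (n₀ + 2) + K := add_le_add (hy'' ν) (hblk p hp ν)
      _ = (K : ℤ) * (n₀ + 3) := by ring
  have hR₀' : ∀ i' ∈ labels (((((ℓ + 1) ^ k : ℕ)) : ℝ) * K) ((ℓ + 1) ^ k) Ω₀c,
      (hh i' (incl hn hsub x) ≠ 0 ∨ hh i' (incl hn hsub ⟨x.1 + e1 μ, hxμ⟩) ≠ 0 ∨ hh i' (incl hn hsub x') ≠ 0 ∨ hh i' (incl hn hsub ⟨x'.1 + e1 μ, hx'μ⟩) ≠ 0) →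
      ∀ j ∈ labels (((((ℓ + 1) ^ k : ℕ)) : ℝ) * K) ((ℓ + 1) ^ k) Ω₀c, (∀ ν, |i' ν - j ν| ≤ (n₀ : ℤ)) → cubeLabels K j ⊆ Ωc := by
    intro i' _ hi j _ hij
    rcases hi with h1 | h2 | h3 | h4
    · exact good_of_R0 ℓ k Ωc hK8 n₀ x (hRp x dx) i' h1 j hij
    · exact good_of_R0 ℓ k Ωc hK8 n₀ (⟨x.1 + e1 μ, hxμ⟩ : ↥(fineDom ((ℓ + 1) ^ k) Ωc)) (hRp (⟨x.1 + e1 μ, hxμ⟩ : ↥(fineDom ((ℓ + 1) ^ k) Ωc)) dy) i' h2 j hij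
    · exact good_of_R0 ℓ k Ωc hK8 n₀ x' (hRp x' dx') i' h3 j hij
    · exact good_of_R0 ℓ k Ωc hK8 n₀ (⟨x'.1 + e1 μ, hx'μ⟩ : ↥(fineDom ((ℓ + 1) ^ k) Ωc)) (hRp (⟨x'.1 + e1 μ, hx'μ⟩ : ↥(fineDom ((ℓ + 1) ^ k) Ωc)) dy') i' h4 j hij
  -- THE CHAIN
  have main := ineq112_holder_lp_apply (X := ↥(fineDom ((ℓ + 1) ^ k) Ω₀c)) (Y := ↥Ω₀c) (κ := ι) hM
    (rpos ((ℓ + 1) ^ k) Ω₀c) (regWt ((ℓ + 1) ^ k) (fineDom ((ℓ + 1) ^ k) Ω₀c)) m2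
    (B1.aSeq a ((ℓ : ℝ) + 1) k * (((((ℓ + 1) ^ k : ℕ)) : ℝ) ^ (d + 1))⁻¹)
    (rBlkWt ((ℓ + 1) ^ k) Ω₀c (fineDom ((ℓ + 1) ^ k) Ω₀c)) (fieldLink F κ (acBond Ω₀c Ac))
    (contourTrans (fieldLink F κ (acBond Ω₀c Ac)) (rbaseEmb hn Ω₀c) (rstairContour hn Ω₀c))
    (fun x z' h μ => regWt_local hn Ω₀c hK8 x z' h μ)
    (fun yb x z' h h' μ => rBlkWt_local hn Ω₀c hK8 yb x z' h h' μ)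
    (labels (((((ℓ + 1) ^ k : ℕ)) : ℝ) * K) ((ℓ + 1) ^ k) Ω₀c) (fun j z h => labels_complete Ω₀c _ j z h)
    (fun j => cubeS ℓ k Ω₀c K j) (fun j z hz => inBox_of_near hn hK1 j z hz)
    (fun j z hz μ => abs_rpos_sub_le_of_cubeS' hn Ω₀c K j z hz μ)
    (fun j yb z z' hz hz' => inBox_iff_of_rBlkWt _ _ hz hz')
    (fun j => cubeW F κ ℓ k Ω₀c K (atField₂ ℓ k Ω₀c Ωc K Ac j) j)
    (fun j => cubeT F κ ℓ k Ω₀c K (atField₂ ℓ k Ω₀c Ωc K Ac j) j)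
    (fun j x z' hx hz' => cubeW_window F κ ℓ k Ω₀c hK1 j hx hz' (atField₂_core ℓ k Ω₀c Ωc Ac hK1 j x z' hx hz'))
    (fun j yb x hyx hx => cubeT_window F κ ℓ k Ω₀c hK1 hK4 j
      (fun u v hu hv _ => atField₂_core ℓ k Ω₀c Ωc Ac hK1 j u v hu hv) yb x hyx hx)
    (inReg ((ℓ + 1) ^ k) Ωc)
    (atGreen₂ F κ ℓ k Ω₀c Ωc hsub K Ac a m2) (fun j _ => atGreen₂_mul F κ ℓ k Ω₀c Ωc hsub K Ac hℓ hk ha hm j)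
    (atGreenΩ F κ ℓ k Ω₀c Ωc hsub K Ac a m2) (fun j _ => atGreenΩ_mul F κ ℓ k Ω₀c Ωc hsub K Ac hℓ hk ha hm j)
    (pairGreen F κ hn Ω₀c Ωc hsub m2 _ (compField Ac)) (pairGreen_mul F κ hn Ω₀c Ωc hsub hak' hm (compField Ac))
    _ (green_mul_op hn Ω₀c F κ hak' hm (regWt ((ℓ + 1) ^ k) (fineDom ((ℓ + 1) ^ k) Ω₀c)) (regWt_nonneg _ _)
      (fun _ _ _ => rfl) (acBond Ω₀c Ac))
    (incl hn hsub x) (incl hn hsub ⟨x.1 + e1 μ, hxμ⟩) (incl hn hsub x') (incl hn hsub ⟨x'.1 + e1 μ, hx'μ⟩) hxy hxx'8 hx'y' (((((ℓ + 1) ^ k : ℕ)) : ℝ) * w) (transport (fieldLink F κ (acBond Ω₀c Ac)) (incl hn hsub x) ll)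
    (fun j => cubeLabels K j ⊆ Ωc) (β := Real.sqrt (Fintype.card ι) * cK) (ω := (vol d ℓ k)⁻¹)
    hn₀ hw hγH0 (by positivity) hγH₂ hγHΩ
    (fun jj hj => by rw [hL2 hj]; exact H0 jj.1 (hgood₀ hj))
    (fun jj hj => by rw [hLΩ hj]; exact H0 jj.1 (hgood₀ hj))
    (fun jj hj t ht1 ht2 g => by rw [hL2 hj]; exact Hgr jj.1 (hgood₀ hj) t ht1 ht2 g)
    (fun jj hj t ht1 ht2 g => by rw [hLΩ hj]; exact Hgr jj.1 (hgood₀ hj) t ht1 ht2 g)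
    (fun jj g => by
      by_cases hj : cubeLabels K jj.1 ⊆ Ωc
      · rw [hL2 hj]; exact H2 jj.1 g
      · exact hLI hj g)
    (fun jj g => by
      by_cases hj : cubeLabels K jj.1 ⊆ Ωc
      · rw [hLΩ hj]; exact H2 jj.1 g
      · exact lpv_two_letterΩ_bad_le F κ ℓ k Ω₀c Ωc hsub K Ac hK1 hj hcK (hbΩ₁ jj.1) (hbΩ₂ jj.1) g)
    h3 hR₀' P hD hD₀ hD₁ f hfP hV hfV i
  -- identify the probe's value with the Hölder quotient of `D^η_{A,μ}(u_Ω − u₀)`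
  set G' := (covOp (regWt ((ℓ + 1) ^ k) (fineDom ((ℓ + 1) ^ k) Ω₀c)) m2
      (B1.aSeq a ((ℓ : ℝ) + 1) k * (((((ℓ + 1) ^ k : ℕ)) : ℝ) ^ (d + 1))⁻¹)
      (rBlkWt ((ℓ + 1) ^ k) Ω₀c (fineDom ((ℓ + 1) ^ k) Ω₀c)) (fieldLink F κ (acBond Ω₀c Ac))
      (contourTrans (fieldLink F κ (acBond Ω₀c Ac)) (rbaseEmb hn Ω₀c) (rstairContour hn Ω₀c)))⁻¹ with hG'def
  set G := pairGreen F κ hn Ω₀c Ωc hsub m2 (B1.aSeq a ((ℓ : ℝ) + 1) k * (((((ℓ + 1) ^ k : ℕ)) : ℝ) ^ (d + 1))⁻¹) (compField Ac) with hGdef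
  set uΩ := (regOp F κ hn Ωc m2 (B1.aSeq a ((ℓ : ℝ) + 1) k * (((((ℓ + 1) ^ k : ℕ)) : ℝ) ^ (d + 1))⁻¹) (compField Ac))⁻¹
      *ᵥ (fun q : ↥(fineDom ((ℓ + 1) ^ k) Ωc) × ι => f (incl hn hsub q.1, q.2)) with huΩ
  set Ψ₀ := G' *ᵥ f with hΨ₀
  have hU : transport (fieldLink F κ (acBond Ω₀c Ac)) (incl hn hsub x) ll = transport (fieldLink F κ (acBond Ωc Ac)) x l := by
    rw [hll_def, transport_map]
    rfl
  have fsub : ∀ z, fld ((G - G') *ᵥ f) z = fld (G *ᵥ f) z - fld Ψ₀ z := fun z => by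
    rw [hΨ₀]; funext i'; simp only [fld_apply, Matrix.sub_mulVec, Pi.sub_apply]
  -- the bonds read on `Ω₀` are the bonds of `Ω`
  have hWxy : (fieldLink F κ (acBond Ω₀c Ac)) (incl hn hsub x) (incl hn hsub ⟨x.1 + e1 μ, hxμ⟩) = (fieldLink F κ (acBond Ωc Ac)) x (⟨x.1 + e1 μ, hxμ⟩ : ↥(fineDom ((ℓ + 1) ^ k) Ωc)) := rfl
  have hWxy' : (fieldLink F κ (acBond Ω₀c Ac)) (incl hn hsub x') (incl hn hsub ⟨x'.1 + e1 μ, hx'μ⟩) = (fieldLink F κ (acBond Ωc Ac)) x' (⟨x'.1 + e1 μ, hx'μ⟩ : ↥(fineDom ((ℓ + 1) ^ k) Ωc)) := rfl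
  have hGx : fld (G *ᵥ f) (incl hn hsub x) = fld uΩ x := funext fun i' => pairGreen_mulVec_incl F κ hn Ω₀c Ωc hsub m2 _ (compField Ac) f x i'
  have hGy : fld (G *ᵥ f) (incl hn hsub ⟨x.1 + e1 μ, hxμ⟩) = fld uΩ (⟨x.1 + e1 μ, hxμ⟩ : ↥(fineDom ((ℓ + 1) ^ k) Ωc)) := funext fun i' => pairGreen_mulVec_incl F κ hn Ω₀c Ωc hsub m2 _ (compField Ac) f (⟨x.1 + e1 μ, hxμ⟩ : ↥(fineDom ((ℓ + 1) ^ k) Ωc)) i'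
  have hGx' : fld (G *ᵥ f) (incl hn hsub x') = fld uΩ x' := funext fun i' => pairGreen_mulVec_incl F κ hn Ω₀c Ωc hsub m2 _ (compField Ac) f x' i'
  have hGy' : fld (G *ᵥ f) (incl hn hsub ⟨x'.1 + e1 μ, hx'μ⟩) = fld uΩ (⟨x'.1 + e1 μ, hx'μ⟩ : ↥(fineDom ((ℓ + 1) ^ k) Ωc)) := funext fun i' => pairGreen_mulVec_incl F κ hn Ω₀c Ωc hsub m2 _ (compField Ac) f (⟨x'.1 + e1 μ, hx'μ⟩ : ↥(fineDom ((ℓ + 1) ^ k) Ωc)) i'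
  have hE1 : (fieldLink F κ (acBond Ω₀c Ac)) (incl hn hsub x') (incl hn hsub ⟨x'.1 + e1 μ, hx'μ⟩) *ᵥ fld ((G - G') *ᵥ f) (incl hn hsub ⟨x'.1 + e1 μ, hx'μ⟩) - fld ((G - G') *ᵥ f) (incl hn hsub x')
      = ((((ℓ + 1) ^ k : ℕ)) : ℝ)⁻¹ • (fld (covDeriv ((ℓ + 1) ^ k) (fineDom ((ℓ + 1) ^ k) Ωc) (fieldLink F κ (acBond Ωc Ac)) μ *ᵥ uΩ) x'
          - fld (covDeriv ((ℓ + 1) ^ k) (fineDom ((ℓ + 1) ^ k) Ω₀c) (fieldLink F κ (acBond Ω₀c Ac)) μ *ᵥ Ψ₀) (incl hn hsub x')) := by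
    rw [fsub, fsub, Matrix.mulVec_sub, hGy', hGx', sub_sub_sub_comm, smul_sub]
    congr 1
    · rw [hWxy', fld_covDeriv_mulVec_of_mem ((ℓ + 1) ^ k) (fieldLink F κ (acBond Ωc Ac)) uΩ hx'μ, smul_smul,
        inv_mul_cancel₀ hnr.ne', one_smul]
    · rw [fld_covDeriv_mulVec_of_mem ((ℓ + 1) ^ k) (fieldLink F κ (acBond Ω₀c Ac)) Ψ₀ hxx'μ, smul_smul,
        inv_mul_cancel₀ hnr.ne', one_smul]
      rfl
  have hE2 : (fieldLink F κ (acBond Ω₀c Ac)) (incl hn hsub x) (incl hn hsub ⟨x.1 + e1 μ, hxμ⟩) *ᵥ fld ((G - G') *ᵥ f) (incl hn hsub ⟨x.1 + e1 μ, hxμ⟩) - fld ((G - G') *ᵥ f) (incl hn hsub x)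
      = ((((ℓ + 1) ^ k : ℕ)) : ℝ)⁻¹ • (fld (covDeriv ((ℓ + 1) ^ k) (fineDom ((ℓ + 1) ^ k) Ωc) (fieldLink F κ (acBond Ωc Ac)) μ *ᵥ uΩ) x
          - fld (covDeriv ((ℓ + 1) ^ k) (fineDom ((ℓ + 1) ^ k) Ω₀c) (fieldLink F κ (acBond Ω₀c Ac)) μ *ᵥ Ψ₀) (incl hn hsub x)) := by
    rw [fsub, fsub, Matrix.mulVec_sub, hGy, hGx, sub_sub_sub_comm, smul_sub]
    congr 1
    · rw [hWxy, fld_covDeriv_mulVec_of_mem ((ℓ + 1) ^ k) (fieldLink F κ (acBond Ωc Ac)) uΩ hxμ, smul_smul,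
        inv_mul_cancel₀ hnr.ne', one_smul]
    · rw [fld_covDeriv_mulVec_of_mem ((ℓ + 1) ^ k) (fieldLink F κ (acBond Ω₀c Ac)) Ψ₀ hxxμ, smul_smul,
        inv_mul_cancel₀ hnr.ne', one_smul]
      rfl
  have hid : (((((ℓ + 1) ^ k : ℕ)) : ℝ) * w) • ((transport (fieldLink F κ (acBond Ω₀c Ac)) (incl hn hsub x) ll) *ᵥ ((fieldLink F κ (acBond Ω₀c Ac)) (incl hn hsub x') (incl hn hsub ⟨x'.1 + e1 μ, hx'μ⟩) *ᵥ fld ((G - G') *ᵥ f) (incl hn hsub ⟨x'.1 + e1 μ, hx'μ⟩) - fld ((G - G') *ᵥ f) (incl hn hsub x'))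
        - ((fieldLink F κ (acBond Ω₀c Ac)) (incl hn hsub x) (incl hn hsub ⟨x.1 + e1 μ, hxμ⟩) *ᵥ fld ((G - G') *ᵥ f) (incl hn hsub ⟨x.1 + e1 μ, hxμ⟩) - fld ((G - G') *ᵥ f) (incl hn hsub x)))
      = w • ((transport (fieldLink F κ (acBond Ωc Ac)) x l
          *ᵥ fld (covDeriv ((ℓ + 1) ^ k) (fineDom ((ℓ + 1) ^ k) Ωc) (fieldLink F κ (acBond Ωc Ac)) μ *ᵥ uΩ) x'
          - fld (covDeriv ((ℓ + 1) ^ k) (fineDom ((ℓ + 1) ^ k) Ωc) (fieldLink F κ (acBond Ωc Ac)) μ *ᵥ uΩ) x)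
        - (transport (fieldLink F κ (acBond Ωc Ac)) x l
          *ᵥ fld (covDeriv ((ℓ + 1) ^ k) (fineDom ((ℓ + 1) ^ k) Ω₀c) (fieldLink F κ (acBond Ω₀c Ac)) μ *ᵥ Ψ₀) (incl hn hsub x')
          - fld (covDeriv ((ℓ + 1) ^ k) (fineDom ((ℓ + 1) ^ k) Ω₀c) (fieldLink F κ (acBond Ω₀c Ac)) μ *ᵥ Ψ₀) (incl hn hsub x))) := by
    rw [hU, hE1, hE2, Matrix.mulVec_smul, ← smul_sub, smul_smul,
      show ((((ℓ + 1) ^ k : ℕ)) : ℝ) * w * ((((ℓ + 1) ^ k : ℕ)) : ℝ)⁻¹ = w by field_simp, Matrix.mulVec_sub, sub_sub_sub_comm]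
  have h54 : (2 : ℝ) ^ (d + 1 + 4) = 2 ^ (d + 5) := by ring_nf
  rw [hid, Pi.smul_apply, smul_eq_mul, abs_mul, abs_of_nonneg hw0, h54] at main
  exact main

end Inputs

/-! ## §2. (1.11)–(1.12), Hölder member, hypothesis-free -/

section Standard

variable {ι : Type} [Fintype ι] [DecidableEq ι]

/-- **[B4] THEOREM p. 573, (1.11)–(1.12) — THE δG CLAUSE, HÖLDER MEMBER (the inequality (1.9) for `δG_k(Ω,Ω₀,A)`),
FOR A GENERAL PAIR `Ω ⊂ Ω₀` UNDER `R₀`, CLOSE PAIRS, UNIFORM IN `η`, HYPOTHESIS-FREE.**  For every `α < 1` there are a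
cube size `K ≥ 16` (`8 ∣ K`) and `c₀ > 0` (depending on `d`, `N`, the flow, `L`, the windows and `α`) such that for
every `(c, β)`, `β > 0`, there is `e₁ > 0` with: for every step `k ≥ 1`, `a ∈ [a₋, a₊]`, `0 ≤ m² ≤ m₊²`, every pair
`Ω ⊆ Ω₀` of finite unions of `K`-blocks, every `A` regular (1.7) on `Ω₀` with `0 < e ≤ e₁`, every direction `μ`, every
pair `x ≠ x′` in `Ω` with `x + e_μ, x′ + e_μ ∈ Ω` and `32|x−x′|_∞ ≤ ηM`, every nearest-neighbour contour `Γ = (x, l)`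
in `Ω` to `x′` of length `≤ (d+1)|x−x′|_∞` within `|x−x′|_∞` of `x`, the `R₀` restriction (every unit label within
`K(d+4)` of the block of `x` is in `Ω`), every `f : Ω₀ → ℝ^N` supported in `P` with `D ≤ dist_∞(x, P)`,
`D₀ ≤ dist_∞(x, Ω^c)`, `D₁ ≤ dist_∞(P, Ω^c)` and `‖f‖_{2,η} ≤ V‖f‖_∞`, every colour `i`
(`u_Ω = G_k(Ω,A)(f|_Ω)`, `u₀ = G_k(Ω₀,A)f`, `U = U(A(Γ))`, `D^η_{A,μ} = B4Lemma21Region.regionDeriv`):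
`(η^{-1}/|x−x′|_∞)^α·|(U(D^η_{A,μ}u_Ω)(x′) − (D^η_{A,μ}u_Ω)(x) − (U(D^η_{A,μ}u₀)(x′) − (D^η_{A,μ}u₀)(x)))_i|`
`≤ c₀·V·exp(−(D + D₀ + D₁)/(2nK))·‖f‖_∞` — for `f` supported in `Ω`, `u_Ω − u₀|_Ω = δG_k(Ω,Ω₀,A)f` and this is
(1.9) for `δG` with the additional factor (1.12).
[cite: Balaban1983RegularityDecay, Theorem p.573 (1.9), (1.11)–(1.12); (1.3)–(1.4) p.572; §2 pp.575–579 (2.2)–(2.22); Lemma 2.1 p.577; Lemma 2.2 pp.577–578] -/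
theorem thm112_holder_region (F : OrthFlow ι) {ℓ₁ : ℝ} (hℓ₁ : 0 ≤ ℓ₁)
    (hLip : ∀ t (v : ι → ℝ), ((F.U t - 1) *ᵥ v) ⬝ᵥ ((F.U t - 1) *ᵥ v) ≤ (ℓ₁ * t) ^ 2 * (v ⬝ᵥ v))
    (d ℓ : ℕ) (hℓ : 1 ≤ ℓ) (amin aplus m2plus : ℝ) (ha : 0 < amin) (α : ℝ) (hα0 : 0 ≤ α) (hα1 : α < 1) :
    ∃ K : ℕ, 16 ≤ K ∧ 8 ∣ K ∧ ∃ c₀ : ℝ, 0 < c₀ ∧ ∀ (creg β : ℝ), 0 ≤ creg → 0 < β →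
      ∃ e₁ : ℝ, 0 < e₁ ∧ ∀ (k : ℕ), 1 ≤ k → ∀ (hn : 1 ≤ (ℓ + 1) ^ k) (a m2 : ℝ),
      amin ≤ a → a ≤ aplus → 0 ≤ m2 → m2 ≤ m2plus →
      ∀ (Ω₀c Ωc : Finset (Fin (d + 1) → ℤ)), IsBlockUnion K Ω₀c → IsBlockUnion K Ωc → ∀ (hsub : Ωc ⊆ Ω₀c)
      (Ac : (Fin (d + 1) → ℤ) → Fin (d + 1) → ℝ) (e : ℝ), 0 < e → e ≤ e₁ →
        (∀ x ∈ fineDom ((ℓ + 1) ^ k) Ω₀c, ∀ μ ν : Fin (d + 1),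
          |Ac (x + e1 μ) ν - Ac x ν| ≤ creg * e ^ (β - 1) / ((ℓ + 1) ^ k : ℕ)) →
      ∀ (μ : Fin (d + 1)) (x x' : ↥(fineDom ((ℓ + 1) ^ k) Ωc)), x.1 + e1 μ ∈ fineDom ((ℓ + 1) ^ k) Ωc →
        x'.1 + e1 μ ∈ fineDom ((ℓ + 1) ^ k) Ωc → x'.1 ≠ x.1 →
        32 * supNorm (x'.1 - x.1) ≤ (((ℓ + 1) ^ k : ℕ) : ℝ) * K →
      ∀ (l : List ↥(fineDom ((ℓ + 1) ^ k) Ωc)), IsNNChain x l → pathEnd x l = x' →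
        (l.length : ℝ) ≤ ((d : ℝ) + 1) * supNorm (x'.1 - x.1) →
        (∀ z ∈ l, supNorm (z.1 - x.1) ≤ supNorm (x'.1 - x.1)) →
        (∀ y : Fin (d + 1) → ℤ, (∀ ν, |y ν - blk ((ℓ + 1) ^ k) x.1 ν| ≤ (K : ℤ) * (d + 4)) → y ∈ Ωc) →
      ∀ (P : ↥(fineDom ((ℓ + 1) ^ k) Ω₀c) → Prop) [DecidablePred P] (D D₀ D₁ : ℝ),
        (∀ x'', P x'' → ∃ ν, D ≤ |rpos ((ℓ + 1) ^ k) Ω₀c (incl hn hsub x) ν - rpos ((ℓ + 1) ^ k) Ω₀c x'' ν|) →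
        (∀ x₁ : ↥(fineDom ((ℓ + 1) ^ k) Ω₀c), ¬ inReg ((ℓ + 1) ^ k) Ωc x₁ →
          ∃ ν, D₀ ≤ |rpos ((ℓ + 1) ^ k) Ω₀c (incl hn hsub x) ν - rpos ((ℓ + 1) ^ k) Ω₀c x₁ ν|) →
        (∀ x'', P x'' → ∀ x₁ : ↥(fineDom ((ℓ + 1) ^ k) Ω₀c), ¬ inReg ((ℓ + 1) ^ k) Ωc x₁ →
          ∃ ν, D₁ ≤ |rpos ((ℓ + 1) ^ k) Ω₀c x₁ ν - rpos ((ℓ + 1) ^ k) Ω₀c x'' ν|) →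
      ∀ (f : ↥(fineDom ((ℓ + 1) ^ k) Ω₀c) × ι → ℝ), (∀ p, ¬ P p.1 → f p = 0) →
      ∀ (V : ℝ), 1 ≤ V → lpv (vol d ℓ k)⁻¹ 2 f ≤ V * ‖f‖ →
      ∀ i : ι,
        ((((ℓ + 1) ^ k : ℕ) : ℝ) / supNorm (x'.1 - x.1)) ^ α *
          |(transport (fieldLink F (e / ((ℓ + 1) ^ k : ℕ)) (acBond Ωc Ac)) x l
              *ᵥ fld (regionDeriv F e ((ℓ + 1) ^ k) Ωc Ac μ
                    *ᵥ ((regionOp F e hn (B1.aSeq a ((ℓ : ℝ) + 1) k) m2 Ωc Ac)⁻¹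
                      *ᵥ (fun q : ↥(fineDom ((ℓ + 1) ^ k) Ωc) × ι => f (incl hn hsub q.1, q.2)))) x'
            - fld (regionDeriv F e ((ℓ + 1) ^ k) Ωc Ac μ
                    *ᵥ ((regionOp F e hn (B1.aSeq a ((ℓ : ℝ) + 1) k) m2 Ωc Ac)⁻¹
                      *ᵥ (fun q : ↥(fineDom ((ℓ + 1) ^ k) Ωc) × ι => f (incl hn hsub q.1, q.2)))) x
            - (transport (fieldLink F (e / ((ℓ + 1) ^ k : ℕ)) (acBond Ωc Ac)) x l
                *ᵥ fld (regionDeriv F e ((ℓ + 1) ^ k) Ω₀c Ac μ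
                      *ᵥ ((regionOp F e hn (B1.aSeq a ((ℓ : ℝ) + 1) k) m2 Ω₀c Ac)⁻¹ *ᵥ f)) (incl hn hsub x')
              - fld (regionDeriv F e ((ℓ + 1) ^ k) Ω₀c Ac μ
                      *ᵥ ((regionOp F e hn (B1.aSeq a ((ℓ : ℝ) + 1) k) m2 Ω₀c Ac)⁻¹ *ᵥ f)) (incl hn hsub x))) i|
          ≤ c₀ * V * Real.exp (-((D + D₀ + D₁) / (2 * (((((ℓ + 1) ^ k : ℕ)) : ℝ) * K)))) * ‖f‖ := by
  -- the constants of the per-cube inputs (Lemma 2.2 at `Ã_j`, (2.20), (2.21), the graded factor; Lemma 2.1)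
  obtain ⟨C₁, hC₁, h₁⟩ := lemma22_sup_cubeField F hℓ₁ hLip d ℓ hℓ amin aplus m2plus ha
  obtain ⟨C₂, hC₂, h₂⟩ := eq220_cubeField_std F hℓ₁ hLip d ℓ hℓ amin aplus m2plus ha
  have hp₁ : (d : ℝ) + 1 < 2 * ((d : ℝ) + 1) := by
    have : (0 : ℝ) ≤ d := Nat.cast_nonneg d
    linarith
  obtain ⟨C₃, hC₃, h₃⟩ := eq221_cubeField F hℓ₁ hLip d ℓ hℓ amin aplus m2plus ha hp₁
  obtain ⟨C₄, hC₄, h₄⟩ := eq221_psup_cubeField_std F hℓ₁ hLip d ℓ hℓ amin aplus m2plus ha hp₁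
  obtain ⟨C₆, hC₆, h₆⟩ := lemma22_holder_cubeField F hℓ₁ hLip d ℓ hℓ amin aplus m2plus ha α hα0 hα1
  have hs : 0 ≤ ((d : ℝ) + 1) * (D1 hprof + D2 hprof) := by
    have := D1_nonneg contDiff_hprof hasCompactSupport_hprof
    have := D2_nonneg contDiff_hprof hasCompactSupport_hprof
    positivity
  have hγ₀ : 0 < min 2 (3 / 4 * amin) / 4 := div_pos (lt_min two_pos (by linarith)) four_pos
  set C₅ : ℝ := (2 * ((d : ℝ) + 1) * (Real.sqrt (min 2 (3 / 4 * amin) / 4))⁻¹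
      + (1 + |aplus|) * (min 2 (3 / 4 * amin) / 4)⁻¹) * (((d : ℝ) + 1) * (D1 hprof + D2 hprof)) with hC₅
  have hC₅0 : 0 ≤ C₅ := by
    have : 0 ≤ (Real.sqrt (min 2 (3 / 4 * amin) / 4))⁻¹ := inv_nonneg.2 (Real.sqrt_nonneg _)
    have : 0 ≤ (min 2 (3 / 4 * amin) / 4)⁻¹ := inv_nonneg.2 hγ₀.le
    positivity
  set Cm : ℝ := C₂ + C₃ + C₄ + C₅ with hCm
  have hCm0 : 0 ≤ Cm := by positivity
  -- the cube size: `3^{d+1}·√N·C_max/K ≤ e^{−1}`, `8 ∣ K`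
  set X : ℝ := (3 : ℝ) ^ (d + 1) * Real.sqrt (Fintype.card ι) * Cm * Real.exp 1 with hX
  have hX0 : 0 ≤ X := by positivity
  set K : ℕ := 16 * (⌈X⌉₊ + 1) with hK
  have hK16 : 16 ≤ K := by omega
  have hK8 : 8 ≤ K := by omega
  have h8 : 8 ∣ K := ⟨2 * (⌈X⌉₊ + 1), by omega⟩
  have hK4 : 4 ∣ K := ⟨4 * (⌈X⌉₊ + 1), by omega⟩
  have hK2 : 2 ≤ K := by omega
  have hK1 : 1 ≤ K := by omega
  have hKr : (0 : ℝ) < K := by exact_mod_cast hK1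
  have hKX : X ≤ K := by
    refine (Nat.le_ceil X).trans ?_
    rw [hK]
    push_cast
    linarith [(Nat.cast_nonneg ⌈X⌉₊ : (0 : ℝ) ≤ ⌈X⌉₊)]
  set cK : ℝ := Cm / K with hcK_def
  have hcK : 0 ≤ cK := div_nonneg hCm0 hKr.le
  have h3 : (3 : ℝ) ^ (d + 1) * (Real.sqrt (Fintype.card ι) * cK) ≤ Real.exp (-1) := by
    have hexp : Real.exp 1 * Real.exp (-1) = 1 := by rw [← Real.exp_add]; norm_num
    have e : (3 : ℝ) ^ (d + 1) * (Real.sqrt (Fintype.card ι) * cK) = X / K * Real.exp (-1) := by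
      rw [hcK_def, hX]
      calc (3 : ℝ) ^ (d + 1) * (Real.sqrt (Fintype.card ι) * (Cm / K))
          = (3 : ℝ) ^ (d + 1) * Real.sqrt (Fintype.card ι) * Cm / K * (Real.exp 1 * Real.exp (-1)) := by
            rw [hexp]; ring
        _ = (3 : ℝ) ^ (d + 1) * Real.sqrt (Fintype.card ι) * Cm * Real.exp 1 / K * Real.exp (-1) := by ring
    rw [e]
    have : X / K ≤ 1 := div_le_one_of_le₀ hKX (Nat.cast_nonneg K)
    calc X / K * Real.exp (-1) ≤ 1 * Real.exp (-1) := mul_le_mul_of_nonneg_right this (Real.exp_pos _).le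
      _ = Real.exp (-1) := one_mul _
  have hCle : ∀ {C : ℝ}, C ≤ Cm → C / K ≤ cK := fun h => div_le_div_of_nonneg_right h hKr.le
  have hC₂le : C₂ / K ≤ cK := hCle (by rw [hCm]; linarith)
  have hC₃le : C₃ / K ≤ cK := hCle (by rw [hCm]; linarith)
  have hC₄le : C₄ / K ≤ cK := hCle (by rw [hCm]; linarith)
  have hC₅le : C₅ / K ≤ cK := hCle (by rw [hCm]; linarith)
  -- the constant `c₀`
  set c₀ : ℝ := 2 ^ (d + 5) * Real.exp (9 / 2)
      * (Real.sqrt (Fintype.card ι) * (C₆ + ((d : ℝ) + 1) * D1 hprof * C₁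
          + ((d : ℝ) + 3) * (((d : ℝ) + 1) * (D1 hprof + D2 hprof)) * C₁
          + ((d : ℝ) + 1) * (D1 hprof ^ 2 + D2 hprof) * C₁)) + 1 with hc₀
  have hD1 := D1_nonneg contDiff_hprof hasCompactSupport_hprof
  have hD2 := D2_nonneg contDiff_hprof hasCompactSupport_hprof
  have hc₀0 : 0 < c₀ := by positivity
  refine ⟨K, hK16, h8, c₀, hc₀0, fun creg β hcreg hβ => ?_⟩
  -- «for e sufficiently small»
  obtain ⟨e₁, he₁, h₁'⟩ := h₁ creg β hcreg hβ (2 * K) K hK1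
  obtain ⟨e₂, he₂, h₂'⟩ := h₂ creg β hcreg hβ K hK2
  obtain ⟨e₃, he₃, h₃'⟩ := h₃ creg β hcreg hβ (2 * K) K hK2
  obtain ⟨e₄, he₄, h₄'⟩ := h₄ creg β hcreg hβ K hK2
  obtain ⟨e₅, he₅, h₅'⟩ := cubeField_threshold d (c := 0) (aplus := aplus) hℓ₁ le_rfl ha hcreg hβ 1 K
  obtain ⟨e₆, he₆, h₆'⟩ := h₆ creg β hcreg hβ (2 * K) K hK1
  refine ⟨min (min (min (min e₁ e₂) (min e₃ e₄)) e₅) e₆,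
    lt_min (lt_min (lt_min (lt_min he₁ he₂) (lt_min he₃ he₄)) he₅) he₆, ?_⟩
  intro k hk hn a m2 ea1 ea2 em1 em2 Ω₀c Ωc hΩ₀ hΩ hsub Ac e he hle' h17 μ x x' hxμ hx'μ hne hclose l hl hlend hlen hlnear
    hxR P _ D D₀ D₁ hD hD₀ hD₁ f hfP V hV hfV i
  have hle : e ≤ min (min (min e₁ e₂) (min e₃ e₄)) e₅ := hle'.trans (min_le_left _ _)
  have hle₆ : e ≤ e₆ := hle'.trans (min_le_right _ _)
  have hle₁ : e ≤ e₁ := hle.trans ((min_le_left _ _).trans ((min_le_left _ _).trans (min_le_left _ _)))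
  have hle₂ : e ≤ e₂ := hle.trans ((min_le_left _ _).trans ((min_le_left _ _).trans (min_le_right _ _)))
  have hle₃ : e ≤ e₃ := hle.trans ((min_le_left _ _).trans ((min_le_right _ _).trans (min_le_left _ _)))
  have hle₄ : e ≤ e₄ := hle.trans ((min_le_left _ _).trans ((min_le_right _ _).trans (min_le_right _ _)))
  have hle₅ : e ≤ e₅ := hle.trans (min_le_right _ _)
  have hn2 : 2 ≤ (ℓ + 1) ^ k := by
    calc 2 ≤ ℓ + 1 := by omega
      _ = (ℓ + 1) ^ 1 := (pow_one _).symm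
      _ ≤ (ℓ + 1) ^ k := Nat.pow_le_pow_right (Nat.succ_pos ℓ) hk
  have hnK : 16 ≤ (ℓ + 1) ^ k * K := le_trans (by norm_num) (Nat.mul_le_mul hn2 hK8)
  have hnK3 : 3 ≤ (ℓ + 1) ^ k * K := le_trans (by norm_num) hnK
  have ha' : 0 < a := lt_of_lt_of_le ha ea1
  have hL : (1 : ℝ) < (ℓ : ℝ) + 1 := by
    have : (1 : ℝ) ≤ ℓ := by exact_mod_cast hℓ
    linarith
  have hak : 0 < B1.aSeq a ((ℓ : ℝ) + 1) k := B1.aSeq_pos ha' hL hk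
  obtain ⟨hak1, hak2⟩ := aSeq_window hℓ hk ha ea1 ea2
  have hvol : 0 ≤ (vol d ℓ k)⁻¹ ^ (2 : ℝ)⁻¹ := Real.rpow_nonneg (inv_nonneg.2 (vol_pos d ℓ k).le) _
  -- the standard box data
  have hM1 : ∀ _i : Fin (d + 1), 1 ≤ 2 * K := fun _ => by omega
  have hMS : ∀ _i : Fin (d + 1), 2 * K ≤ 2 * K := fun _ => le_rfl
  have hKM : ∀ _i : Fin (d + 1), K ∣ 2 * K := fun _ => Dvd.intro_left 2 rfl
  have hj1 : ∀ _i : Fin (d + 1), (1 : ℤ) ≤ 1 := fun _ => le_rfl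
  have hj2 : ∀ _i : Fin (d + 1), (K : ℤ) * (1 + 1) ≤ ((2 * K : ℕ) : ℤ) := fun _ => by push_cast; omega
  -- Lemma 2.1's `‖·‖_{2,2}` letter on a finite union `R ⊆ Ω₀` of `K`-blocks (the three kinds of sub-regions)
  have hbR : ∀ (R : Finset (Fin (d + 1) → ℤ)), R ⊆ Ω₀c → IsBlockUnion K R → ∀ (j : Fin (d + 1) → ℤ)
      (Φ : ↥(fineDom ((ℓ + 1) ^ k) R) × ι → ℝ),
      lpW d ℓ k 2 (opK (regWt ((ℓ + 1) ^ k) (fineDom ((ℓ + 1) ^ k) (R))) m2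
            (B1.aSeq a ((ℓ : ℝ) + 1) k * (((((ℓ + 1) ^ k : ℕ)) : ℝ) ^ (d + 1))⁻¹)
            (rBlkWt ((ℓ + 1) ^ k) (R) (fineDom ((ℓ + 1) ^ k) (R)))
            (fieldLink F (e / ((ℓ + 1) ^ k : ℕ)) (acBond (R) Ac))
            (contourTrans (fieldLink F (e / ((ℓ + 1) ^ k : ℕ)) (acBond (R) Ac)) (rbaseEmb hn (R))
              (rstairContour hn (R)))
            (fun a : ↥(fineDom ((ℓ + 1) ^ k) (R)) => hZ ((ℓ + 1) ^ k) K j a.1)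
          *ᵥ ((covOp (regWt ((ℓ + 1) ^ k) (fineDom ((ℓ + 1) ^ k) (R))) m2
                (B1.aSeq a ((ℓ : ℝ) + 1) k * (((((ℓ + 1) ^ k : ℕ)) : ℝ) ^ (d + 1))⁻¹)
                (rBlkWt ((ℓ + 1) ^ k) (R) (fineDom ((ℓ + 1) ^ k) (R)))
                (fieldLink F (e / ((ℓ + 1) ^ k : ℕ)) (acBond (R) Ac))
                (contourTrans (fieldLink F (e / ((ℓ + 1) ^ k : ℕ)) (acBond (R) Ac)) (rbaseEmb hn (R))
                  (rstairContour hn (R))))⁻¹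
            *ᵥ (mulH (ι := ι) (fun a : ↥(fineDom ((ℓ + 1) ^ k) (R)) => hZ ((ℓ + 1) ^ k) K j a.1) *ᵥ Φ))) ≤ cK * lpW d ℓ k 2 Φ := by
    intro R hR hRB j Φ
    obtain ⟨_, hsm, _⟩ := h₅' e he hle₅ _ hak1 hak2
    have hsmall : ℓ₁ ^ 2 * (((d : ℝ) + 1) * creg * e ^ β) ^ 2 * ((d : ℝ) + 1)
        * (1 + B1.aSeq a ((ℓ : ℝ) + 1) k * ((d : ℝ) + 1)) ≤ min 2 (B1.aSeq a ((ℓ : ℝ) + 1) k) / 4 := by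
      simpa only [Nat.cast_one, mul_one] using hsm
    have hL := eq221_l2_region_hZ F hℓ₁ hLip he hn hak em1 R hcreg
      (fun y hy => h17 y (fineDom_mono hn hR hy)) hsmall hnK3 hRB j Φ
    have step : lpM 2 (kOpR F e hn (B1.aSeq a ((ℓ : ℝ) + 1) k) m2 R Ac (fun x => hZ ((ℓ + 1) ^ k) K j x.1)
        *ᵥ ((regionOp F e hn (B1.aSeq a ((ℓ : ℝ) + 1) k) m2 R Ac)⁻¹
          *ᵥ (mulH (ι := ι) (fun x : ↥(fineDom ((ℓ + 1) ^ k) R) => hZ ((ℓ + 1) ^ k) K j x.1) *ᵥ Φ)))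
        ≤ cK * lpM 2 Φ := by
      refine hL.trans (mul_le_mul_of_nonneg_right ?_ (lpM_nonneg 2 Φ))
      refine le_trans ?_ hC₅le
      rw [hC₅]
      calc (2 * ((d : ℝ) + 1) * (Real.sqrt (min 2 (B1.aSeq a ((ℓ : ℝ) + 1) k) / 4 + m2))⁻¹
            + (1 + B1.aSeq a ((ℓ : ℝ) + 1) k) * (min 2 (B1.aSeq a ((ℓ : ℝ) + 1) k) / 4 + m2)⁻¹)
            * (((d : ℝ) + 1) * (D1 hprof + D2 hprof)) / K
          = (2 * ((d : ℝ) + 1) * (Real.sqrt (min 2 (B1.aSeq a ((ℓ : ℝ) + 1) k) / 4 + m2))⁻¹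
            + (1 + B1.aSeq a ((ℓ : ℝ) + 1) k) * (min 2 (B1.aSeq a ((ℓ : ℝ) + 1) k) / 4 + m2)⁻¹)
            * (((d : ℝ) + 1) * (D1 hprof + D2 hprof)) * (K : ℝ)⁻¹ := div_eq_mul_inv _ _
        _ ≤ (2 * ((d : ℝ) + 1) * (Real.sqrt (min 2 (3 / 4 * amin) / 4))⁻¹
            + (1 + |aplus|) * (min 2 (3 / 4 * amin) / 4)⁻¹) * (((d : ℝ) + 1) * (D1 hprof + D2 hprof))
            * (K : ℝ)⁻¹ := mul_le_mul_of_nonneg_right (l2_const_le d ha hak1 hak2 em1 hs) (inv_nonneg.2 hKr.le)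
        _ = _ := (div_eq_mul_inv _ _).symm
    show (vol d ℓ k)⁻¹ ^ (2 : ℝ)⁻¹ * lpM 2 _ ≤ cK * ((vol d ℓ k)⁻¹ ^ (2 : ℝ)⁻¹ * lpM 2 Φ)
    calc (vol d ℓ k)⁻¹ ^ (2 : ℝ)⁻¹ * lpM 2 _ ≤ (vol d ℓ k)⁻¹ ^ (2 : ℝ)⁻¹ * (cK * lpM 2 Φ) :=
          mul_le_mul_of_nonneg_left step hvol
      _ = cK * ((vol d ℓ k)⁻¹ ^ (2 : ℝ)⁻¹ * lpM 2 Φ) := by ring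
  -- the other two kinds of sub-regions are finite unions of `K`-blocks inside `Ω₀`
  have hsd : ∀ j : Fin (d + 1) → ℤ, IsBlockUnion K (subLabels Ω₀c K j \ (Ωc ∩ cubeLabels K j)) := by
    intro j y hy z hz
    rw [Finset.mem_sdiff] at hy ⊢
    refine ⟨isBlockUnion_subLabels Ω₀c hK1 hΩ₀ j hy.1 hz, fun hzc => hy.2 ?_⟩
    exact isBlockUnion_subLabels Ωc hK1 hΩ j hzc hz.symm
  -- the main chain with the inputs discharged
  have main := thm112_holder_region_of_inputs F (e / ((ℓ + 1) ^ k : ℕ)) hℓ hk hn Ω₀c Ωc hsub hK16 hK4 ha' em1 Ac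
    hC₁.le hcK (n₀ := d + 1) (Nat.succ_pos d)
    -- Lemma 2.2 (2.17), sup member, at `Ã_j`
    (fun j hj Φ => (h₁' k hk hn hnK a m2 ea1 ea2 em1 em2 (fun _ => 2 * K) hM1 hMS (fun _ => 1) hj1 hj2
      (AcS ℓ k K Ac j) e he hle₁ (regular_AcS h17 hj) Φ).1)
    -- (2.20)
    (fun j hj Φ => (h₂' k hk hn hnK a m2 ea1 ea2 em1 em2 (AcS ℓ k K Ac j) e he hle₂ (regular_AcS h17 hj) Φ).trans
      (mul_le_mul_of_nonneg_right hC₂le (supN_nonneg Φ)))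
    -- the graded factor `‖·‖_{∞,p₁}` of (2.21)
    (fun j hj p hp Φ => by
      have hp' : 2 * ((d : ℝ) + 1) ≤ p := by push_cast at hp; linarith
      exact (h₄' k hk hn hnK a m2 ea1 ea2 em1 em2 (AcS ℓ k K Ac j) e he hle₄ (regular_AcS h17 hj) p hp' Φ).trans
        (mul_le_mul_of_nonneg_right hC₄le (lpW_nonneg d ℓ k p Φ)))
    -- (2.21)
    (fun j hj p q hp hpq hdiff Φ => by
      have hdiff' : p⁻¹ - q⁻¹ ≤ (2 * ((d : ℝ) + 1))⁻¹ := by push_cast at hdiff; exact hdiff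
      exact (h₃' k hk hn hnK a m2 ea1 ea2 em1 em2 (fun _ => 2 * K) hM1 hMS hKM (fun _ => 1) hj1 hj2
        (AcS ℓ k K Ac j) e he hle₃ (regular_AcS h17 hj) p q hp hpq hdiff' Φ).trans
        (mul_le_mul_of_nonneg_right hC₃le (lpW_nonneg d ℓ k p Φ)))
    -- Lemma 2.1's `‖·‖_{2,2}` on `Ω₀ ∩ □̂_j`, on `Ω ∩ □̂_j`, on `(Ω₀∖Ω) ∩ □̂_j`
    (fun j Φ => hbR (subLabels Ω₀c K j) (subLabels_subset Ω₀c K j) (isBlockUnion_subLabels Ω₀c hK1 hΩ₀ j) j Φ)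
    (fun j Φ => hbR (Ωc ∩ cubeLabels K j) ((subLabels_subset Ωc K j).trans hsub)
      (isBlockUnion_subLabels Ωc hK1 hΩ j) j Φ)
    (fun j Φ => hbR (subLabels Ω₀c K j \ (Ωc ∩ cubeLabels K j))
      (Finset.sdiff_subset.trans (subLabels_subset Ω₀c K j)) (hsd j) j Φ)
    hC₁.le hC₆.le μ
    -- Lemma 2.2 (2.17), derivative sup members, at `Ã_j`
    (fun j hj ν Φ => ((h₁' k hk hn hnK a m2 ea1 ea2 em1 em2 (fun _ => 2 * K) hM1 hMS (fun _ => 1) hj1 hj2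
      (AcS ℓ k K Ac j) e he hle₁ (regular_AcS h17 hj) Φ).2 ν))
    hα0 hα1.le
    -- Lemma 2.2 (2.16), the Hölder member, at `Ã_j`
    (fun j hj a0 a0' ha0μ ha0'μ hneB lB hlB hlendB hlenB Φ =>
      h₆' k hk hn hnK a m2 ea1 ea2 em1 em2 (fun _ => 2 * K) hM1 hMS (fun _ => 1) hj1 hj2 (AcS ℓ k K Ac j) e he hle₆
        (regular_AcS h17 hj) μ a0 ⟨a0.1 + e1 μ, ha0μ⟩ a0' ⟨a0'.1 + e1 μ, ha0'μ⟩ rfl rfl hneB lB hlB hlendB hlenB Φ)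
    h3 x x' hxμ hx'μ hne hclose l hl hlend hlen hlnear
    (fun y hy => hxR y fun ν => by have h := hy ν; push_cast at h ⊢; linarith)
    P hD hD₀ hD₁ f hfP hV hfV i
  have hreg : ∀ (R : Finset (Fin (d + 1) → ℤ)), regionOp F e hn (B1.aSeq a ((ℓ : ℝ) + 1) k) m2 R Ac
      = covOp (regWt ((ℓ + 1) ^ k) (fineDom ((ℓ + 1) ^ k) R)) m2
          (B1.aSeq a ((ℓ : ℝ) + 1) k * (((((ℓ + 1) ^ k : ℕ)) : ℝ) ^ (d + 1))⁻¹)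
          (rBlkWt ((ℓ + 1) ^ k) R (fineDom ((ℓ + 1) ^ k) R)) (fieldLink F (e / ((ℓ + 1) ^ k : ℕ)) (acBond R Ac))
          (contourTrans (fieldLink F (e / ((ℓ + 1) ^ k : ℕ)) (acBond R Ac)) (rbaseEmb hn R)
            (rstairContour hn R)) := fun R => rfl
  have hreg' : regionOp F e hn (B1.aSeq a ((ℓ : ℝ) + 1) k) m2 Ωc Ac
      = regOp F (e / ((ℓ + 1) ^ k : ℕ)) hn Ωc m2 (B1.aSeq a ((ℓ : ℝ) + 1) k * (((((ℓ + 1) ^ k : ℕ)) : ℝ) ^ (d + 1))⁻¹)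
          (compField Ac) := rfl
  have hder : ∀ (R : Finset (Fin (d + 1) → ℤ)), regionDeriv F e ((ℓ + 1) ^ k) R Ac μ
      = covDeriv ((ℓ + 1) ^ k) (fineDom ((ℓ + 1) ^ k) R) (fieldLink F (e / ((ℓ + 1) ^ k : ℕ)) (acBond R Ac)) μ :=
    fun R => rfl
  rw [hreg', hreg Ω₀c, hder Ωc, hder Ω₀c]
  have hV0 : 0 ≤ V := zero_le_one.trans hV
  refine main.trans ?_
  have hrest : 0 ≤ V * Real.exp (-((D + D₀ + D₁) / (2 * (((((ℓ + 1) ^ k : ℕ)) : ℝ) * K)))) * ‖f‖ := by positivity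
  have hle : 2 ^ (d + 5) * Real.exp (9 / 2)
        * (Real.sqrt (Fintype.card ι) * (C₆ + ((d : ℝ) + 1) * D1 hprof * C₁
            + ((d : ℝ) + 3) * (((d : ℝ) + 1) * (D1 hprof + D2 hprof)) * C₁
            + ((d : ℝ) + 1) * (D1 hprof ^ 2 + D2 hprof) * C₁)) ≤ c₀ := by
    rw [hc₀]; linarith
  calc 2 ^ (d + 5) * Real.exp (9 / 2)
        * (Real.sqrt (Fintype.card ι) * (C₆ + ((d : ℝ) + 1) * D1 hprof * C₁
            + ((d : ℝ) + 3) * (((d : ℝ) + 1) * (D1 hprof + D2 hprof)) * C₁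
            + ((d : ℝ) + 1) * (D1 hprof ^ 2 + D2 hprof) * C₁))
        * V * Real.exp (-((D + D₀ + D₁) / (2 * (((((ℓ + 1) ^ k : ℕ)) : ℝ) * K)))) * ‖f‖
      = (2 ^ (d + 5) * Real.exp (9 / 2)
        * (Real.sqrt (Fintype.card ι) * (C₆ + ((d : ℝ) + 1) * D1 hprof * C₁
            + ((d : ℝ) + 3) * (((d : ℝ) + 1) * (D1 hprof + D2 hprof)) * C₁
            + ((d : ℝ) + 1) * (D1 hprof ^ 2 + D2 hprof) * C₁)))
        * (V * Real.exp (-((D + D₀ + D₁) / (2 * (((((ℓ + 1) ^ k : ℕ)) : ℝ) * K)))) * ‖f‖) := by ring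
    _ ≤ c₀ * (V * Real.exp (-((D + D₀ + D₁) / (2 * (((((ℓ + 1) ^ k : ℕ)) : ℝ) * K)))) * ‖f‖) := mul_le_mul_of_nonneg_right hle hrest
    _ = c₀ * V * Real.exp (-((D + D₀ + D₁) / (2 * (((((ℓ + 1) ^ k : ℕ)) : ℝ) * K)))) * ‖f‖ := by ring

end Standard

end

end Literature.MathematicalPhysics.QuantumFieldTheory.Balaban1983to89.B4Thm112RegionLpHolder
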